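/-
Copyright (c) 2026 the pub-hodgecm-mathlib formalisation cell (harness21).  Prover seat hodgecm-mathlib-F0P2-p06 (g13): road «S3-ram» (LEAD F0P3a-plan (g12); architect
A-p16 (g31); junction pen F0P3a-p01 (g17), J-PACK v2 ROW-O; owner F0P3a-p06 (g15)); 2026-09-02.
-/
import Literature.NumberTheory.Automorphic.UnitaryLatticeTreeResidualDatumRamified          -- ★ p847483 (this seat): G3⁵ residual datum + junction-ready line counts; brings G3⁗ G3‴ G3″ G3′ G3⁺ J6-mult, FILE K
import Literature.NumberTheory.Automorphic.UnitaryLatticeTreeOddVertexChildLabelsRamified   -- p847497 (this seat): ROW-O label side per line; brings ★ FILES J H F E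
import Literature.NumberTheory.Automorphic.UnitaryLatticeTreeFixedGrandchildFrameRamified    -- ★ p847469 (F0P2-p01): FILE L frames of grandchildren
import Literature.NumberTheory.Automorphic.UnitaryLatticeTreeFixedGrandchildrenSliceCountRamified  -- ★ p847357 (this seat, g12): J6-mult slice count
import HarnessLib

/-!
# The lattice graph of a hermitian space — J-PACK v2 ROW-O «ODD REGULAR VERTEX» AT THE FRAME (tamely ramified place): the fixed grandchildren of a fixed self-dual vertex
# `v = u·L₀` of odd depth `d ≥ 3` and rank two are `q` of label `(d−1, rank 2)` and `q.choose 2 + q.choose 2` of label `(d−2, rank ≤ 1)` by class (Kottwitz 1986 §3)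

Topic `NumberTheory/Automorphic`; namespace `Literature.NumberTheory.Automorphic.UnitaryLatticeTree`.  THEOREMS ONLY (no definition, no instance, no notation, no named fact,
no `sorry`); kernel lane `--supports stmt-HodgeConjecture-24833`.  Cell `pub/hodgecm-mathlib` (D-0151), crux H413; road «S3-ram» (Literature seeding, count-neutral);
J-PACK v2 (junction pen F0P3a-p01 (g17)) **ROW-O**, the COUNT ∕ ASSEMBLY at the frame `v = latticeGraphIso u r₀`: tokens `LEV (ϖ^d) v`, `¬ LEV₂ (ϖ^{2d+1}) v`,
`LEV₃ (ϖ^{3d+1}) v`, `d` odd `≥ 3`, and the two KERNEL INPUTS in frame form — the PARENT's line is `Q_Ȳ`-null and every OTHER neighbour's line is off `ker Ȳ` (= the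
orientation hypothesis `hup` of Ω⁺ read through ★ J §1 ∕ FILE M; the Ω⁺ wrapper discharges them) — give the four ROW-O conclusions VERBATIM (J-PACK v2 §2): label dichotomy of
`GC v`, `#{(d−1)-grandchildren} = q`, `#{(d−2)-grandchildren with CLS c} = q.choose 2 = #{… with ¬CLS c}`.  Assembly of ★ J6-mult (p847357: `#{w ∈ GC v | P w} = q·#{children
along which P}`), ★ FILE L (frames), ★ O-LBL (labels per line, class exclusion), ★ G3 (children = `(uκ)·N₁`, passing at level `≥ 2`), ★ G3⁵ ∕ G3⁗ ∕ G3‴ (line counts: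
`2` null lines, `(q−1)∕2` per class), ★ G1 (rooted-tree bookkeeping: the parent is the unique inward neighbour).

* §1 `exists_childCoords_of_frame` (coordinates `(a, b)` of a grandchild in a GIVEN frame `uκ` of its modular parent — ★ FILE L with the frame fixed);
  `quadraticChar_mul_eq_one_iff_exists_sq`, `quadraticChar_mul_eq_neg_one_iff` (token classes ↔ `χ`-classes in `𝓀`).
* §2 **`rowO_of_frame`** — the four conclusions from the frame-form hypotheses.

HONEST LABEL: HC_CM is proved only modulo the 2 remaining named inputs (hLiu418 24832, h413 24833) until rung 0 closes; nothing printed is asserted here (bookkeeping over ★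
results); «S3-ram» has no books consequence.

## References
* [Kottwitz1986] R. E. Kottwitz, *Base change for unit elements of Hecke algebras*, Compositio Math. 60 (1986), §3 (counting fixed lattices shell by shell).
* [BruhatTits1972] F. Bruhat, J. Tits, *Groupes réductifs sur un corps local I*, Publ. Math. IHÉS 41 (1972), §10 (lattice models; vertex stabilisers).
* [Tits1979] J. Tits, *Reductive groups over local fields*, PSPM 33.1 (1979), §2.4, §3.5 (ramified `U(3)`; reduction mod `𝔭`).
* [Serre1980Trees] J.-P. Serre, *Trees* (1980), Ch. I §2.3, Ch. II §1.1 (rooted trees; neighbours of a lattice).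
-/

set_option autoImplicit false

noncomputable section

open scoped Valued WithZero Matrix MatrixGroups

namespace Literature.NumberTheory.Automorphic.UnitaryLatticeTree

open Literature.NumberTheory.Automorphic Literature.NumberTheory.Automorphic.HermitianLattice
open Literature.NumberTheory.Automorphic.CartanUnique Literature.NumberTheory.Automorphic.UnitaryGroup
open Literature.Combinatorics.SimpleGraph.TreeLayers
open Literature.GroupTheory.SpecificGroups

variable {K : Type*} [Field K] [Valued K ℤᵐ⁰] {σ : K →+* K} {ϖ : K}

/-! ## §1 Coordinates of a grandchild in a given frame; token classes ↔ `χ`-classes -/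

/-- **COORDINATES IN A GIVEN FRAME** (★ FILE L with the frame FIXED): if `c = (uκ)·N₁` (`κ ∈ K₀`) and `w ≠ u·L₀` is adjacent to `c`, then `w = latt((uκ)·g(a,b))` for some
`|a| = 1`, `|b| ≤ 1`. [cite: BruhatTits1972, §10] [cite: Serre1980Trees, II.1.1] -/
theorem exists_childCoords_of_frame (hvσ : ∀ a, Valued.v (σ a) = Valued.v a) (hσϖ : σ ϖ = -ϖ)
    (hϖ : Valued.v ϖ = WithZero.exp (-1 : ℤ)) (hres : ∀ x : K, Valued.v x ≤ 1 → Valued.v (σ x - x) < 1)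
    (u : unitaryGroupOfForm σ ((StdForm.antidiagonal 3).over K))
    {κ : unitaryGroupOfForm σ ((StdForm.antidiagonal 3).over K)} (hκ : κ ∈ unitaryInt σ ((StdForm.antidiagonal 3).over K))
    {c w : {M : Submodule 𝒪[K] (Fin 3 → K) // IsVertex σ ϖ ((StdForm.antidiagonal 3).over K) M}}
    (hcκ : c = latticeGraphIso σ ϖ ((StdForm.antidiagonal 3).over K) (u * κ) ⟨latt (Matrix.diagonal ![(1 : K), 1, ϖ]), 2, isVertexLattice_two_N₁_of_neg hσϖ hϖ⟩)
    (hw : w ∈ (latticeGraph σ ϖ ((StdForm.antidiagonal 3).over K)).neighborSet c)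
    (hne : w ≠ latticeGraphIso σ ϖ ((StdForm.antidiagonal 3).over K) u ⟨stdLattice K 3, 0, isSelfDualLattice_stdLattice_three_of_v hϖ⟩) :
    ∃ a b : K, Valued.v a = 1 ∧ Valued.v b ≤ 1 ∧
      w.1 = latt ((((u * κ : unitaryGroupOfForm σ ((StdForm.antidiagonal 3).over K)) : GL (Fin 3) K) : Matrix (Fin 3) (Fin 3) K) * !![a / ϖ, 0, 0; 0, 1, 0; b, 0, ϖ]) := by
  -- pull `w` back along `uκ`: a neighbour of `N₁` other than `L₀`
  set w' := latticeGraphIso σ ϖ ((StdForm.antidiagonal 3).over K) (u * κ)⁻¹ w with hw'def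
  have hww' : latticeGraphIso σ ϖ ((StdForm.antidiagonal 3).over K) (u * κ) w' = w := latticeGraphIso_mul_inv_apply _ _
  have hw' : w' ∈ (latticeGraph σ ϖ ((StdForm.antidiagonal 3).over K)).neighborSet ⟨latt (Matrix.diagonal ![(1 : K), 1, ϖ]), 2, isVertexLattice_two_N₁_of_neg hσϖ hϖ⟩ := by
    rw [SimpleGraph.mem_neighborSet] at hw ⊢
    rw [hcκ, ← hww'] at hw
    exact (latticeGraphIso σ ϖ ((StdForm.antidiagonal 3).over K) (u * κ)).map_adj_iff.1 hw
  have hne' : w'.1 ≠ stdLattice K 3 := by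
    intro h
    apply hne
    have hroot : w' = ⟨stdLattice K 3, 0, isSelfDualLattice_stdLattice_three_of_v hϖ⟩ := Subtype.ext h
    rw [← hww', hroot, latticeGraphIso_mul_apply, latticeGraphIso_root_eq_of_mem_unitaryInt hϖ hκ]
  obtain ⟨a, b, ha, hb, hw'1⟩ := exists_unit_vec_of_mem_neighborSet_N₁_of_ne_stdLattice hvσ hσϖ hϖ hres hw' hne'
  refine ⟨a, b, ha, hb, ?_⟩
  rw [← hww', latticeGraphIso_apply_val, hw'1, latt_coe_mul_childFrame_eq hϖ _ ha hb]

/-- In a finite field of odd characteristic: `t` lies in the square class of the unit `s` (`∃ a ≠ 0, t = s·a²`) iff `χ(s·t) = 1`. [cite: Kottwitz1986, §3] -/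
theorem quadraticChar_mul_eq_one_iff_exists_sq {F : Type*} [Field F] [Fintype F] [DecidableEq F] {s : F} (hs : s ≠ 0) (t : F) :
    (∃ a : F, a ≠ 0 ∧ t = s * a ^ 2) ↔ quadraticChar F (s * t) = 1 := by
  constructor
  · rintro ⟨a, ha, rfl⟩
    rw [show s * (s * a ^ 2) = (s * a) ^ 2 by ring]
    exact quadraticChar_sq_one' (mul_ne_zero hs ha)
  · intro h
    have hst : s * t ≠ 0 := fun h0 => by rw [h0, quadraticChar_zero] at h; exact zero_ne_one h
    obtain ⟨b, hb⟩ := (quadraticChar_one_iff_isSquare hst).1 h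
    have hb0 : b ≠ 0 := fun hb0 => hst (by rw [hb, hb0, mul_zero])
    refine ⟨b / s, div_ne_zero hb0 hs, ?_⟩
    field_simp
    linear_combination hb

/-- … and `t ≠ 0` lies OUTSIDE the square class of `s` iff `χ(s·t) = −1`. [cite: Kottwitz1986, §3] -/
theorem quadraticChar_mul_eq_neg_one_iff {F : Type*} [Field F] [Fintype F] [DecidableEq F] {s : F} (hs : s ≠ 0) (t : F) :
    (t ≠ 0 ∧ ¬ ∃ a : F, a ≠ 0 ∧ t = s * a ^ 2) ↔ quadraticChar F (s * t) = -1 := by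
  rw [quadraticChar_mul_eq_one_iff_exists_sq hs]
  constructor
  · rintro ⟨ht, h1⟩
    exact (quadraticChar_dichotomy (mul_ne_zero hs ht)).resolve_left h1
  · intro h
    refine ⟨fun ht => ?_, fun h1 => ?_⟩
    · rw [ht, mul_zero, quadraticChar_zero] at h; exact absurd h (by decide)
    · rw [h1] at h; exact absurd h (by decide)

/-! ## §2 ROW-O at the frame -/

set_option maxHeartbeats 2000000 in
-- one assembly theorem with ~40 intermediate facts: the default heartbeat budget per command does not suffice
/-- **ROW-O «ODD REGULAR VERTEX» AT THE FRAME `v = u·L₀`.**  Tokens: `(γ−1)·v ⊆ ϖ^d·v`, `¬ (γ−1)²·v ⊆ ϖ^{2d+1}·v` (rank two), `(γ−1)³·v ⊆ ϖ^{3d+1}·v` (residual nilpotency),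
`d` odd, `3 ≤ d`; `p` the parent of `v` (the inward neighbour); KERNEL INPUTS in frame form: the parent's line is `Q_Ȳ`-null, every other neighbour's line is off `ker Ȳ`.
THEN (J-PACK v2 §2 ROW-O): every fixed grandchild `w ∈ GC v` is `(d−1, rank 2)` or `(d−2, rank ≤ 1)`; `#{(d−1)} = q`; `#{(d−2) ∧ CLS c} = q.choose 2 = #{(d−2) ∧ ¬CLS c}`
for every unit `c`. [cite: Kottwitz1986, §3] [cite: BruhatTits1972, §10] [cite: Tits1979, §3.5] [cite: Serre1980Trees, I.2.3] -/
theorem rowO_of_frame (hσ : ∀ x, σ (σ x) = x) (hvσ : ∀ a, Valued.v (σ a) = Valued.v a) (hσϖ : σ ϖ = -ϖ)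
    (hϖ : Valued.v ϖ = WithZero.exp (-1 : ℤ)) (hres : ∀ x : K, Valued.v x ≤ 1 → Valued.v (σ x - x) < 1) (h2 : Valued.v (2 : K) = 1) [Finite 𝓀[K]]
    (hT : (latticeGraph σ ϖ ((StdForm.antidiagonal 3).over K)).IsTree)
    {γ : unitaryGroupOfForm σ ((StdForm.antidiagonal 3).over K)}
    (u : unitaryGroupOfForm σ ((StdForm.antidiagonal 3).over K))
    (hvr : latticeGraphIso σ ϖ ((StdForm.antidiagonal 3).over K) u ⟨stdLattice K 3, 0, isSelfDualLattice_stdLattice_three_of_v hϖ⟩ ≠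
      ⟨stdLattice K 3, 0, isSelfDualLattice_stdLattice_three_of_v hϖ⟩)
    (hfix : latticeGraphIso σ ϖ ((StdForm.antidiagonal 3).over K) γ
        (latticeGraphIso σ ϖ ((StdForm.antidiagonal 3).over K) u ⟨stdLattice K 3, 0, isSelfDualLattice_stdLattice_three_of_v hϖ⟩) =
      latticeGraphIso σ ϖ ((StdForm.antidiagonal 3).over K) u ⟨stdLattice K 3, 0, isSelfDualLattice_stdLattice_three_of_v hϖ⟩)
    {d : ℕ} (hd : Odd d) (hd3 : 3 ≤ d)
    (hlev : (latticeGraphIso σ ϖ ((StdForm.antidiagonal 3).over K) u ⟨stdLattice K 3, 0, isSelfDualLattice_stdLattice_three_of_v hϖ⟩).1.map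
          ((Matrix.toLin' (((γ : GL (Fin 3) K) : Matrix (Fin 3) (Fin 3) K) - 1)).restrictScalars 𝒪[K]) ≤
        scaleLattice (ϖ ^ d) (latticeGraphIso σ ϖ ((StdForm.antidiagonal 3).over K) u ⟨stdLattice K 3, 0, isSelfDualLattice_stdLattice_three_of_v hϖ⟩).1)
    (hrk : ¬ (latticeGraphIso σ ϖ ((StdForm.antidiagonal 3).over K) u ⟨stdLattice K 3, 0, isSelfDualLattice_stdLattice_three_of_v hϖ⟩).1.map
          ((Matrix.toLin' ((((γ : GL (Fin 3) K) : Matrix (Fin 3) (Fin 3) K) - 1) ^ 2)).restrictScalars 𝒪[K]) ≤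
        scaleLattice (ϖ ^ (2 * d + 1)) (latticeGraphIso σ ϖ ((StdForm.antidiagonal 3).over K) u ⟨stdLattice K 3, 0, isSelfDualLattice_stdLattice_three_of_v hϖ⟩).1)
    (hnil : (latticeGraphIso σ ϖ ((StdForm.antidiagonal 3).over K) u ⟨stdLattice K 3, 0, isSelfDualLattice_stdLattice_three_of_v hϖ⟩).1.map
          ((Matrix.toLin' ((((γ : GL (Fin 3) K) : Matrix (Fin 3) (Fin 3) K) - 1) ^ 3)).restrictScalars 𝒪[K]) ≤
        scaleLattice (ϖ ^ (3 * d + 1)) (latticeGraphIso σ ϖ ((StdForm.antidiagonal 3).over K) u ⟨stdLattice K 3, 0, isSelfDualLattice_stdLattice_three_of_v hϖ⟩).1)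
    (c : K) (hc : Valued.v c = 1)
    (p : {M : Submodule 𝒪[K] (Fin 3 → K) // IsVertex σ ϖ ((StdForm.antidiagonal 3).over K) M})
    (hp : (latticeGraph σ ϖ ((StdForm.antidiagonal 3).over K)).Adj (latticeGraphIso σ ϖ ((StdForm.antidiagonal 3).over K) u ⟨stdLattice K 3, 0, isSelfDualLattice_stdLattice_three_of_v hϖ⟩) p)
    (hpin : (latticeGraph σ ϖ ((StdForm.antidiagonal 3).over K)).dist ⟨stdLattice K 3, 0, isSelfDualLattice_stdLattice_three_of_v hϖ⟩ p + 1 =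
      (latticeGraph σ ϖ ((StdForm.antidiagonal 3).over K)).dist ⟨stdLattice K 3, 0, isSelfDualLattice_stdLattice_three_of_v hϖ⟩
        (latticeGraphIso σ ϖ ((StdForm.antidiagonal 3).over K) u ⟨stdLattice K 3, 0, isSelfDualLattice_stdLattice_three_of_v hϖ⟩))
    (hparnull : ∀ κ : unitaryGroupOfForm σ ((StdForm.antidiagonal 3).over K), κ ∈ unitaryInt σ ((StdForm.antidiagonal 3).over K) →
      p = latticeGraphIso σ ϖ ((StdForm.antidiagonal 3).over K) (u * κ) ⟨latt (Matrix.diagonal ![(1 : K), 1, ϖ]), 2, isVertexLattice_two_N₁_of_neg hσϖ hϖ⟩ →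
      Valued.v ((((((u * κ : unitaryGroupOfForm σ ((StdForm.antidiagonal 3).over K)) : GL (Fin 3) K)⁻¹ : GL (Fin 3) K) : Matrix (Fin 3) (Fin 3) K) *
        (((γ : GL (Fin 3) K) : Matrix (Fin 3) (Fin 3) K) - 1) * (((u * κ : unitaryGroupOfForm σ ((StdForm.antidiagonal 3).over K)) : GL (Fin 3) K) : Matrix (Fin 3) (Fin 3) K)) 2 0) ≤
        Valued.v ϖ ^ (d + 1))
    (hker : ∀ κ : unitaryGroupOfForm σ ((StdForm.antidiagonal 3).over K), κ ∈ unitaryInt σ ((StdForm.antidiagonal 3).over K) →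
      latticeGraphIso σ ϖ ((StdForm.antidiagonal 3).over K) (u * κ) ⟨latt (Matrix.diagonal ![(1 : K), 1, ϖ]), 2, isVertexLattice_two_N₁_of_neg hσϖ hϖ⟩ ≠ p →
      ¬ ∀ i, Valued.v ((((((u * κ : unitaryGroupOfForm σ ((StdForm.antidiagonal 3).over K)) : GL (Fin 3) K)⁻¹ : GL (Fin 3) K) : Matrix (Fin 3) (Fin 3) K) *
        (((γ : GL (Fin 3) K) : Matrix (Fin 3) (Fin 3) K) - 1) * (((u * κ : unitaryGroupOfForm σ ((StdForm.antidiagonal 3).over K)) : GL (Fin 3) K) : Matrix (Fin 3) (Fin 3) K)) i 0) ≤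
        Valued.v ϖ ^ (d + 1)) :
    (∀ w ∈ {w | ∃ c', ((latticeGraph σ ϖ ((StdForm.antidiagonal 3).over K)).Adj (latticeGraphIso σ ϖ ((StdForm.antidiagonal 3).over K) u ⟨stdLattice K 3, 0, isSelfDualLattice_stdLattice_three_of_v hϖ⟩) c' ∧
          (latticeGraph σ ϖ ((StdForm.antidiagonal 3).over K)).dist ⟨stdLattice K 3, 0, isSelfDualLattice_stdLattice_three_of_v hϖ⟩ c' =
            (latticeGraph σ ϖ ((StdForm.antidiagonal 3).over K)).dist ⟨stdLattice K 3, 0, isSelfDualLattice_stdLattice_three_of_v hϖ⟩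
              (latticeGraphIso σ ϖ ((StdForm.antidiagonal 3).over K) u ⟨stdLattice K 3, 0, isSelfDualLattice_stdLattice_three_of_v hϖ⟩) + 1 ∧
          latticeGraphIso σ ϖ ((StdForm.antidiagonal 3).over K) γ c' = c') ∧
        ((latticeGraph σ ϖ ((StdForm.antidiagonal 3).over K)).Adj c' w ∧
          (latticeGraph σ ϖ ((StdForm.antidiagonal 3).over K)).dist ⟨stdLattice K 3, 0, isSelfDualLattice_stdLattice_three_of_v hϖ⟩ w =
            (latticeGraph σ ϖ ((StdForm.antidiagonal 3).over K)).dist ⟨stdLattice K 3, 0, isSelfDualLattice_stdLattice_three_of_v hϖ⟩ c' + 1 ∧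
          latticeGraphIso σ ϖ ((StdForm.antidiagonal 3).over K) γ w = w)},
      (w.1.map ((Matrix.toLin' (((γ : GL (Fin 3) K) : Matrix (Fin 3) (Fin 3) K) - 1)).restrictScalars 𝒪[K]) ≤ scaleLattice (ϖ ^ (d - 1)) w.1 ∧
        ¬ w.1.map ((Matrix.toLin' (((γ : GL (Fin 3) K) : Matrix (Fin 3) (Fin 3) K) - 1)).restrictScalars 𝒪[K]) ≤ scaleLattice (ϖ ^ d) w.1 ∧
        ¬ w.1.map ((Matrix.toLin' ((((γ : GL (Fin 3) K) : Matrix (Fin 3) (Fin 3) K) - 1) ^ 2)).restrictScalars 𝒪[K]) ≤ scaleLattice (ϖ ^ (2 * d - 1)) w.1) ∨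
      (w.1.map ((Matrix.toLin' (((γ : GL (Fin 3) K) : Matrix (Fin 3) (Fin 3) K) - 1)).restrictScalars 𝒪[K]) ≤ scaleLattice (ϖ ^ (d - 2)) w.1 ∧
        ¬ w.1.map ((Matrix.toLin' (((γ : GL (Fin 3) K) : Matrix (Fin 3) (Fin 3) K) - 1)).restrictScalars 𝒪[K]) ≤ scaleLattice (ϖ ^ (d - 1)) w.1 ∧
        w.1.map ((Matrix.toLin' ((((γ : GL (Fin 3) K) : Matrix (Fin 3) (Fin 3) K) - 1) ^ 2)).restrictScalars 𝒪[K]) ≤ scaleLattice (ϖ ^ (2 * d - 3)) w.1)) ∧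
    {w | (∃ c', ((latticeGraph σ ϖ ((StdForm.antidiagonal 3).over K)).Adj (latticeGraphIso σ ϖ ((StdForm.antidiagonal 3).over K) u ⟨stdLattice K 3, 0, isSelfDualLattice_stdLattice_three_of_v hϖ⟩) c' ∧
          (latticeGraph σ ϖ ((StdForm.antidiagonal 3).over K)).dist ⟨stdLattice K 3, 0, isSelfDualLattice_stdLattice_three_of_v hϖ⟩ c' =
            (latticeGraph σ ϖ ((StdForm.antidiagonal 3).over K)).dist ⟨stdLattice K 3, 0, isSelfDualLattice_stdLattice_three_of_v hϖ⟩
              (latticeGraphIso σ ϖ ((StdForm.antidiagonal 3).over K) u ⟨stdLattice K 3, 0, isSelfDualLattice_stdLattice_three_of_v hϖ⟩) + 1 ∧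
          latticeGraphIso σ ϖ ((StdForm.antidiagonal 3).over K) γ c' = c') ∧
        ((latticeGraph σ ϖ ((StdForm.antidiagonal 3).over K)).Adj c' w ∧
          (latticeGraph σ ϖ ((StdForm.antidiagonal 3).over K)).dist ⟨stdLattice K 3, 0, isSelfDualLattice_stdLattice_three_of_v hϖ⟩ w =
            (latticeGraph σ ϖ ((StdForm.antidiagonal 3).over K)).dist ⟨stdLattice K 3, 0, isSelfDualLattice_stdLattice_three_of_v hϖ⟩ c' + 1 ∧
          latticeGraphIso σ ϖ ((StdForm.antidiagonal 3).over K) γ w = w)) ∧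
        (w.1.map ((Matrix.toLin' (((γ : GL (Fin 3) K) : Matrix (Fin 3) (Fin 3) K) - 1)).restrictScalars 𝒪[K]) ≤ scaleLattice (ϖ ^ (d - 1)) w.1 ∧ ¬ w.1.map ((Matrix.toLin' (((γ : GL (Fin 3) K) : Matrix (Fin 3) (Fin 3) K) - 1)).restrictScalars 𝒪[K]) ≤ scaleLattice (ϖ ^ (d)) w.1)}.ncard = Nat.card 𝓀[K] ∧
    {w | (∃ c', ((latticeGraph σ ϖ ((StdForm.antidiagonal 3).over K)).Adj (latticeGraphIso σ ϖ ((StdForm.antidiagonal 3).over K) u ⟨stdLattice K 3, 0, isSelfDualLattice_stdLattice_three_of_v hϖ⟩) c' ∧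
          (latticeGraph σ ϖ ((StdForm.antidiagonal 3).over K)).dist ⟨stdLattice K 3, 0, isSelfDualLattice_stdLattice_three_of_v hϖ⟩ c' =
            (latticeGraph σ ϖ ((StdForm.antidiagonal 3).over K)).dist ⟨stdLattice K 3, 0, isSelfDualLattice_stdLattice_three_of_v hϖ⟩
              (latticeGraphIso σ ϖ ((StdForm.antidiagonal 3).over K) u ⟨stdLattice K 3, 0, isSelfDualLattice_stdLattice_three_of_v hϖ⟩) + 1 ∧
          latticeGraphIso σ ϖ ((StdForm.antidiagonal 3).over K) γ c' = c') ∧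
        ((latticeGraph σ ϖ ((StdForm.antidiagonal 3).over K)).Adj c' w ∧
          (latticeGraph σ ϖ ((StdForm.antidiagonal 3).over K)).dist ⟨stdLattice K 3, 0, isSelfDualLattice_stdLattice_three_of_v hϖ⟩ w =
            (latticeGraph σ ϖ ((StdForm.antidiagonal 3).over K)).dist ⟨stdLattice K 3, 0, isSelfDualLattice_stdLattice_three_of_v hϖ⟩ c' + 1 ∧
          latticeGraphIso σ ϖ ((StdForm.antidiagonal 3).over K) γ w = w)) ∧
        (w.1.map ((Matrix.toLin' (((γ : GL (Fin 3) K) : Matrix (Fin 3) (Fin 3) K) - 1)).restrictScalars 𝒪[K]) ≤ scaleLattice (ϖ ^ (d - 2)) w.1 ∧ ¬ w.1.map ((Matrix.toLin' (((γ : GL (Fin 3) K) : Matrix (Fin 3) (Fin 3) K) - 1)).restrictScalars 𝒪[K]) ≤ scaleLattice (ϖ ^ (d - 1)) w.1) ∧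
        (∃ y ∈ w.1, ∃ a' : K, Valued.v a' = 1 ∧
          Valued.v ((ϖ ^ (d - 2))⁻¹ * pairing σ ((StdForm.antidiagonal 3).over K) y ((((γ : GL (Fin 3) K) : Matrix (Fin 3) (Fin 3) K) - 1) *ᵥ y) - c * a' ^ 2) < 1)}.ncard = (Nat.card 𝓀[K]).choose 2 ∧
    {w | (∃ c', ((latticeGraph σ ϖ ((StdForm.antidiagonal 3).over K)).Adj (latticeGraphIso σ ϖ ((StdForm.antidiagonal 3).over K) u ⟨stdLattice K 3, 0, isSelfDualLattice_stdLattice_three_of_v hϖ⟩) c' ∧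
          (latticeGraph σ ϖ ((StdForm.antidiagonal 3).over K)).dist ⟨stdLattice K 3, 0, isSelfDualLattice_stdLattice_three_of_v hϖ⟩ c' =
            (latticeGraph σ ϖ ((StdForm.antidiagonal 3).over K)).dist ⟨stdLattice K 3, 0, isSelfDualLattice_stdLattice_three_of_v hϖ⟩
              (latticeGraphIso σ ϖ ((StdForm.antidiagonal 3).over K) u ⟨stdLattice K 3, 0, isSelfDualLattice_stdLattice_three_of_v hϖ⟩) + 1 ∧
          latticeGraphIso σ ϖ ((StdForm.antidiagonal 3).over K) γ c' = c') ∧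
        ((latticeGraph σ ϖ ((StdForm.antidiagonal 3).over K)).Adj c' w ∧
          (latticeGraph σ ϖ ((StdForm.antidiagonal 3).over K)).dist ⟨stdLattice K 3, 0, isSelfDualLattice_stdLattice_three_of_v hϖ⟩ w =
            (latticeGraph σ ϖ ((StdForm.antidiagonal 3).over K)).dist ⟨stdLattice K 3, 0, isSelfDualLattice_stdLattice_three_of_v hϖ⟩ c' + 1 ∧
          latticeGraphIso σ ϖ ((StdForm.antidiagonal 3).over K) γ w = w)) ∧
        (w.1.map ((Matrix.toLin' (((γ : GL (Fin 3) K) : Matrix (Fin 3) (Fin 3) K) - 1)).restrictScalars 𝒪[K]) ≤ scaleLattice (ϖ ^ (d - 2)) w.1 ∧ ¬ w.1.map ((Matrix.toLin' (((γ : GL (Fin 3) K) : Matrix (Fin 3) (Fin 3) K) - 1)).restrictScalars 𝒪[K]) ≤ scaleLattice (ϖ ^ (d - 1)) w.1) ∧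
        ¬ (∃ y ∈ w.1, ∃ a' : K, Valued.v a' = 1 ∧
          Valued.v ((ϖ ^ (d - 2))⁻¹ * pairing σ ((StdForm.antidiagonal 3).over K) y ((((γ : GL (Fin 3) K) : Matrix (Fin 3) (Fin 3) K) - 1) *ᵥ y) - c * a' ^ 2) < 1)}.ncard = (Nat.card 𝓀[K]).choose 2 := by
  classical
  -- ### abbreviations
  set r : {M : Submodule 𝒪[K] (Fin 3 → K) // IsVertex σ ϖ ((StdForm.antidiagonal 3).over K) M} :=
    ⟨stdLattice K 3, 0, isSelfDualLattice_stdLattice_three_of_v hϖ⟩ with hr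
  set N₁v : {M : Submodule 𝒪[K] (Fin 3 → K) // IsVertex σ ϖ ((StdForm.antidiagonal 3).over K) M} :=
    ⟨latt (Matrix.diagonal ![(1 : K), 1, ϖ]), 2, isVertexLattice_two_N₁_of_neg hσϖ hϖ⟩ with hN₁v
  set v := latticeGraphIso σ ϖ ((StdForm.antidiagonal 3).over K) u r with hvdef
  have hϖ0 : ϖ ≠ 0 := uniformizer_ne_zero hϖ
  have hvϖ0 : Valued.v ϖ ≠ 0 := (Valuation.ne_zero_iff _).2 hϖ0
  have hϖ1 : Valued.v ϖ ≤ 1 := by rw [hϖ, ← WithZero.exp_zero]; exact WithZero.exp_le_exp.2 (by norm_num)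
  have hpow : ∀ {m n : ℕ}, n ≤ m → Valued.v ϖ ^ m ≤ Valued.v ϖ ^ n := fun {m n} h => pow_le_pow_right_of_le_one' hϖ1 h
  have hd1 : 1 ≤ d := by omega
  have hd2 : 2 ≤ d := by omega
  -- ### the element in the frame `u`: `γ′ = u⁻¹γu ∈ K₀` of level `ϖ^d`
  have hγK : u⁻¹ * γ * u ∈ unitaryInt σ ((StdForm.antidiagonal 3).over K) := mem_unitaryInt_conj_of_latticeGraphIso_apply_root_eq hfix
  have hMd : ∀ i j, Valued.v (((((u⁻¹ * γ * u : unitaryGroupOfForm σ ((StdForm.antidiagonal 3).over K)) : GL (Fin 3) K) : Matrix (Fin 3) (Fin 3) K) - 1) i j) ≤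
      Valued.v ϖ ^ d := fun i j => by
    rw [← map_pow]; exact (forall_v_conj_sub_one_le_iff_map_sub_one_le_scaleLattice γ u (pow_ne_zero _ hϖ0)).1 hlev i j
  have hM1 : ∀ i j, Valued.v (((((u⁻¹ * γ * u : unitaryGroupOfForm σ ((StdForm.antidiagonal 3).over K)) : GL (Fin 3) K) : Matrix (Fin 3) (Fin 3) K) - 1) i j) ≤
      Valued.v ϖ := fun i j => by
    have h : Valued.v ϖ ^ d ≤ Valued.v ϖ ^ 1 := hpow hd1
    rw [pow_one] at h
    exact (hMd i j).trans h
  have hM2 : ∀ i j, Valued.v (((((u⁻¹ * γ * u : unitaryGroupOfForm σ ((StdForm.antidiagonal 3).over K)) : GL (Fin 3) K) : Matrix (Fin 3) (Fin 3) K) - 1) i j) ≤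
      Valued.v ϖ ^ 2 := fun i j => (hMd i j).trans (hpow hd2)
  have hlev1 : v.1.map ((Matrix.toLin' (((γ : GL (Fin 3) K) : Matrix (Fin 3) (Fin 3) K) - 1)).restrictScalars 𝒪[K]) ≤ scaleLattice ϖ v.1 :=
    (forall_v_conj_sub_one_le_iff_map_sub_one_le_scaleLattice γ u hϖ0).2 hM1
  have hvS : IsSelfDualLattice σ ϖ ((StdForm.antidiagonal 3).over K) v.1 :=
    isVertexLattice_mapGL σ ϖ _ _ u.2 (isSelfDualLattice_stdLattice_three_of_v hϖ)
  -- ### tokens in a child frame `uκ`, `κ ∈ K₀`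
  have hvκ : ∀ κ : unitaryGroupOfForm σ ((StdForm.antidiagonal 3).over K), κ ∈ unitaryInt σ ((StdForm.antidiagonal 3).over K) →
      latticeGraphIso σ ϖ ((StdForm.antidiagonal 3).over K) (u * κ) r = v := fun κ hκ => by
    rw [latticeGraphIso_mul_apply, latticeGraphIso_root_eq_of_mem_unitaryInt hϖ hκ]
  have hlatt : ∀ κ : unitaryGroupOfForm σ ((StdForm.antidiagonal 3).over K), κ ∈ unitaryInt σ ((StdForm.antidiagonal 3).over K) →
      latt (((u * κ : unitaryGroupOfForm σ ((StdForm.antidiagonal 3).over K)) : GL (Fin 3) K) : Matrix (Fin 3) (Fin 3) K) = v.1 := fun κ hκ => by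
    rw [← hvκ κ hκ]; rfl
  have hMκ : ∀ κ : unitaryGroupOfForm σ ((StdForm.antidiagonal 3).over K), κ ∈ unitaryInt σ ((StdForm.antidiagonal 3).over K) →
      ∀ i j, Valued.v ((((((u * κ : unitaryGroupOfForm σ ((StdForm.antidiagonal 3).over K)) : GL (Fin 3) K)⁻¹ : GL (Fin 3) K) : Matrix (Fin 3) (Fin 3) K) *
        (((γ : GL (Fin 3) K) : Matrix (Fin 3) (Fin 3) K) - 1) * (((u * κ : unitaryGroupOfForm σ ((StdForm.antidiagonal 3).over K)) : GL (Fin 3) K) : Matrix (Fin 3) (Fin 3) K)) i j) ≤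
        Valued.v ϖ ^ d := by
    intro κ hκ i j
    have hlev' : (mapGL ((u * κ : unitaryGroupOfForm σ ((StdForm.antidiagonal 3).over K)) : GL (Fin 3) K) (stdLattice K 3)).map
          ((Matrix.toLin' (((γ : GL (Fin 3) K) : Matrix (Fin 3) (Fin 3) K) - 1)).restrictScalars 𝒪[K]) ≤
        scaleLattice (ϖ ^ d) (mapGL ((u * κ : unitaryGroupOfForm σ ((StdForm.antidiagonal 3).over K)) : GL (Fin 3) K) (stdLattice K 3)) := by
      rw [show mapGL ((u * κ : unitaryGroupOfForm σ ((StdForm.antidiagonal 3).over K)) : GL (Fin 3) K) (stdLattice K 3) = v.1 from congrArg Subtype.val (hvκ κ hκ)]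
      exact hlev
    rw [coe_inv_mul_sub_one_mul_coe_eq, ← map_pow]
    exact (forall_v_conj_sub_one_le_iff_map_sub_one_le_scaleLattice γ (u * κ) (pow_ne_zero _ hϖ0)).1 hlev' i j
  have hlevκ : ∀ κ : unitaryGroupOfForm σ ((StdForm.antidiagonal 3).over K), κ ∈ unitaryInt σ ((StdForm.antidiagonal 3).over K) →
      (latt (((u * κ : unitaryGroupOfForm σ ((StdForm.antidiagonal 3).over K)) : GL (Fin 3) K) : Matrix (Fin 3) (Fin 3) K)).map
          ((Matrix.toLin' (((γ : GL (Fin 3) K) : Matrix (Fin 3) (Fin 3) K) - 1)).restrictScalars 𝒪[K]) ≤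
        scaleLattice (ϖ ^ d) (latt (((u * κ : unitaryGroupOfForm σ ((StdForm.antidiagonal 3).over K)) : GL (Fin 3) K) : Matrix (Fin 3) (Fin 3) K)) := fun κ hκ => by
    rw [hlatt κ hκ]; exact hlev
  have hnilκ : ∀ κ : unitaryGroupOfForm σ ((StdForm.antidiagonal 3).over K), κ ∈ unitaryInt σ ((StdForm.antidiagonal 3).over K) →
      (latt (((u * κ : unitaryGroupOfForm σ ((StdForm.antidiagonal 3).over K)) : GL (Fin 3) K) : Matrix (Fin 3) (Fin 3) K)).map
          ((Matrix.toLin' ((((γ : GL (Fin 3) K) : Matrix (Fin 3) (Fin 3) K) - 1) ^ 3)).restrictScalars 𝒪[K]) ≤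
        scaleLattice (ϖ ^ (3 * d + 1)) (latt (((u * κ : unitaryGroupOfForm σ ((StdForm.antidiagonal 3).over K)) : GL (Fin 3) K) : Matrix (Fin 3) (Fin 3) K)) := fun κ hκ => by
    rw [hlatt κ hκ]; exact hnil
  -- ### rooted-tree bookkeeping: the parent is the unique inward neighbour, every other neighbour is a child
  obtain ⟨par, hpar, hchild, -, -⟩ := exists_rooted_parent hT r
  have hpv : p = par v := by
    by_contra hne
    have h := (hchild v p hvr hp hne).1
    omega
  have hchild' : ∀ c', (latticeGraph σ ϖ ((StdForm.antidiagonal 3).over K)).Adj v c' → (latticeGraph σ ϖ ((StdForm.antidiagonal 3).over K)).dist r c' = (latticeGraph σ ϖ ((StdForm.antidiagonal 3).over K)).dist r v + 1 → c' ≠ p := by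
    intro c' _ hdc heq
    rw [heq] at hdc
    omega
  -- ### PER CHILD: a frame, coordinates of the grandchildren, and their labels
  -- frame of a child
  have hframe : ∀ c', (latticeGraph σ ϖ ((StdForm.antidiagonal 3).over K)).Adj v c' → ∃ κ : unitaryGroupOfForm σ ((StdForm.antidiagonal 3).over K), κ ∈ unitaryInt σ ((StdForm.antidiagonal 3).over K) ∧
      c' = latticeGraphIso σ ϖ ((StdForm.antidiagonal 3).over K) (u * κ) N₁v := fun c' hadj =>
    (mem_neighborSet_latticeGraphIso_root_iff hσ hvσ hσϖ hϖ h2 u c').1 ((SimpleGraph.mem_neighborSet _ _ _).2 hadj)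
  -- labels through a NULL outward line
  have hnullLab : ∀ (κ : unitaryGroupOfForm σ ((StdForm.antidiagonal 3).over K)) (hκ : κ ∈ unitaryInt σ ((StdForm.antidiagonal 3).over K))
      (c' w : {M : Submodule 𝒪[K] (Fin 3 → K) // IsVertex σ ϖ ((StdForm.antidiagonal 3).over K) M}),
      c' = latticeGraphIso σ ϖ ((StdForm.antidiagonal 3).over K) (u * κ) N₁v → c' ≠ p → (latticeGraph σ ϖ ((StdForm.antidiagonal 3).over K)).Adj c' w → w ≠ v →
      Valued.v ((((((u * κ : unitaryGroupOfForm σ ((StdForm.antidiagonal 3).over K)) : GL (Fin 3) K)⁻¹ : GL (Fin 3) K) : Matrix (Fin 3) (Fin 3) K) *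
        (((γ : GL (Fin 3) K) : Matrix (Fin 3) (Fin 3) K) - 1) * (((u * κ : unitaryGroupOfForm σ ((StdForm.antidiagonal 3).over K)) : GL (Fin 3) K) : Matrix (Fin 3) (Fin 3) K)) 2 0) ≤
        Valued.v ϖ ^ (d + 1) →
      (w.1.map ((Matrix.toLin' (((γ : GL (Fin 3) K) : Matrix (Fin 3) (Fin 3) K) - 1)).restrictScalars 𝒪[K]) ≤ scaleLattice (ϖ ^ (d - 1)) w.1 ∧
        ¬ w.1.map ((Matrix.toLin' (((γ : GL (Fin 3) K) : Matrix (Fin 3) (Fin 3) K) - 1)).restrictScalars 𝒪[K]) ≤ scaleLattice (ϖ ^ d) w.1 ∧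
        ¬ w.1.map ((Matrix.toLin' ((((γ : GL (Fin 3) K) : Matrix (Fin 3) (Fin 3) K) - 1) ^ 2)).restrictScalars 𝒪[K]) ≤ scaleLattice (ϖ ^ (2 * d - 1)) w.1) := by
    intro κ hκ c' w hcκ hcp hcw hwv h20
    obtain ⟨a, b, ha, hb, hw1⟩ := exists_childCoords_of_frame hvσ hσϖ hϖ hres u hκ hcκ ((SimpleGraph.mem_neighborSet _ _ _).2 hcw) hwv
    have hcol := hker κ hκ (fun h => hcp (hcκ.trans h))
    rw [hw1]
    exact childLabels_of_null_of_not_col hvσ hϖ (u * κ) γ ha hb hd1 (hMκ κ hκ) (hlevκ κ hκ) (hnilκ κ hκ) h20 (by exact fun h => hcol h)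
  -- labels through a NON-NULL line
  have hclassLab : ∀ (κ : unitaryGroupOfForm σ ((StdForm.antidiagonal 3).over K)) (hκ : κ ∈ unitaryInt σ ((StdForm.antidiagonal 3).over K))
      (c' w : {M : Submodule 𝒪[K] (Fin 3 → K) // IsVertex σ ϖ ((StdForm.antidiagonal 3).over K) M}),
      c' = latticeGraphIso σ ϖ ((StdForm.antidiagonal 3).over K) (u * κ) N₁v → (latticeGraph σ ϖ ((StdForm.antidiagonal 3).over K)).Adj c' w → w ≠ v →
      ¬ Valued.v ((((((u * κ : unitaryGroupOfForm σ ((StdForm.antidiagonal 3).over K)) : GL (Fin 3) K)⁻¹ : GL (Fin 3) K) : Matrix (Fin 3) (Fin 3) K) *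
        (((γ : GL (Fin 3) K) : Matrix (Fin 3) (Fin 3) K) - 1) * (((u * κ : unitaryGroupOfForm σ ((StdForm.antidiagonal 3).over K)) : GL (Fin 3) K) : Matrix (Fin 3) (Fin 3) K)) 2 0) ≤
        Valued.v ϖ ^ (d + 1) →
      (w.1.map ((Matrix.toLin' (((γ : GL (Fin 3) K) : Matrix (Fin 3) (Fin 3) K) - 1)).restrictScalars 𝒪[K]) ≤ scaleLattice (ϖ ^ (d - 2)) w.1 ∧
        ¬ w.1.map ((Matrix.toLin' (((γ : GL (Fin 3) K) : Matrix (Fin 3) (Fin 3) K) - 1)).restrictScalars 𝒪[K]) ≤ scaleLattice (ϖ ^ (d - 1)) w.1 ∧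
        w.1.map ((Matrix.toLin' ((((γ : GL (Fin 3) K) : Matrix (Fin 3) (Fin 3) K) - 1) ^ 2)).restrictScalars 𝒪[K]) ≤ scaleLattice (ϖ ^ (2 * d - 3)) w.1) ∧
      ∀ c₁ : K, Valued.v c₁ = 1 →
        ((∃ y ∈ w.1, ∃ a' : K, Valued.v a' = 1 ∧
          Valued.v ((ϖ ^ (d - 2))⁻¹ * pairing σ ((StdForm.antidiagonal 3).over K) y ((((γ : GL (Fin 3) K) : Matrix (Fin 3) (Fin 3) K) - 1) *ᵥ y) - c₁ * a' ^ 2) < 1) ↔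
        ∃ a₀ : K, Valued.v a₀ = 1 ∧ Valued.v ((ϖ ^ d)⁻¹ * (((((u * κ : unitaryGroupOfForm σ ((StdForm.antidiagonal 3).over K)) : GL (Fin 3) K)⁻¹ : GL (Fin 3) K) : Matrix (Fin 3) (Fin 3) K) *
          (((γ : GL (Fin 3) K) : Matrix (Fin 3) (Fin 3) K) - 1) * (((u * κ : unitaryGroupOfForm σ ((StdForm.antidiagonal 3).over K)) : GL (Fin 3) K) : Matrix (Fin 3) (Fin 3) K)) 2 0 -
          (-c₁) * a₀ ^ 2) < 1) := by
    intro κ hκ c' w hcκ hcw hwv h20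
    obtain ⟨a, b, ha, hb, hw1⟩ := exists_childCoords_of_frame hvσ hσϖ hϖ hres u hκ hcκ ((SimpleGraph.mem_neighborSet _ _ _).2 hcw) hwv
    rw [hw1]
    exact ⟨childLabels_of_not_null hϖ (u * κ) γ ha hb hd2 (hMκ κ hκ) h20,
      fun c₁ hc₁ => childClass_iff_lineClass_neg hvσ hσϖ hϖ hres (u * κ) γ ha hb hd2 (hMκ κ hκ) hc₁⟩
  -- ### the line predicates of a frame, in valuation and in residue currency
  -- the conjugated matrix in the frame `uκ` is `κ⁻¹ M κ`, `M = u⁻¹γu − 1`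
  have hMrel : ∀ κ : unitaryGroupOfForm σ ((StdForm.antidiagonal 3).over K),
      ((((u * κ : unitaryGroupOfForm σ ((StdForm.antidiagonal 3).over K)) : GL (Fin 3) K)⁻¹ : GL (Fin 3) K) : Matrix (Fin 3) (Fin 3) K) * (((γ : GL (Fin 3) K) : Matrix (Fin 3) (Fin 3) K) - 1) * (((u * κ : unitaryGroupOfForm σ ((StdForm.antidiagonal 3).over K)) : GL (Fin 3) K) : Matrix (Fin 3) (Fin 3) K) = (((κ : GL (Fin 3) K)⁻¹ : GL (Fin 3) K) : Matrix (Fin 3) (Fin 3) K) * ((((u⁻¹ * γ * u : unitaryGroupOfForm σ ((StdForm.antidiagonal 3).over K)) : GL (Fin 3) K) : Matrix (Fin 3) (Fin 3) K) - 1) * ((κ : GL (Fin 3) K) : Matrix (Fin 3) (Fin 3) K) := fun κ => by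
    rw [coe_inv_mul_sub_one_mul_coe_eq, coe_inv_mul_sub_one_mul_coe_eq,
      show (u * κ)⁻¹ * γ * (u * κ) = κ⁻¹ * (u⁻¹ * γ * u) * κ by group]
  -- the corner of the frame `uκ` is the form value on the line `κe₀`
  have hcorner : ∀ κ : unitaryGroupOfForm σ ((StdForm.antidiagonal 3).over K),
      (((((u * κ : unitaryGroupOfForm σ ((StdForm.antidiagonal 3).over K)) : GL (Fin 3) K)⁻¹ : GL (Fin 3) K) : Matrix (Fin 3) (Fin 3) K) * (((γ : GL (Fin 3) K) : Matrix (Fin 3) (Fin 3) K) - 1) * (((u * κ : unitaryGroupOfForm σ ((StdForm.antidiagonal 3).over K)) : GL (Fin 3) K) : Matrix (Fin 3) (Fin 3) K)) 2 0 =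
      B₀ σ 3 (((κ : GL (Fin 3) K) : Matrix (Fin 3) (Fin 3) K) *ᵥ (Pi.single 0 1)) (((((u⁻¹ * γ * u : unitaryGroupOfForm σ ((StdForm.antidiagonal 3).over K)) : GL (Fin 3) K) : Matrix (Fin 3) (Fin 3) K) - 1) *ᵥ (((κ : GL (Fin 3) K) : Matrix (Fin 3) (Fin 3) K) *ᵥ (Pi.single 0 1))) := fun κ => by
    rw [hMrel, inv_mul_mul_apply_two_zero_eq_B₀, col_zero_eq_mulVec_single]
  -- the residue field and its character
  haveI : Fintype 𝓀[K] := Fintype.ofFinite _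
  have hq : 0 < Nat.card 𝓀[K] := Nat.card_pos
  have hcO : (-c) ∈ 𝒪[K] := (Valuation.mem_integer_iff _ _).2 (by rw [Valuation.map_neg, hc])
  have hcres : IsLocalRing.residue 𝒪[K] ⟨-c, hcO⟩ ≠ 0 := by
    rw [Ne, residue_eq_zero_iff_v_lt_one]
    exact fun hlt => (ne_of_lt hlt) (by rw [Valuation.map_neg, hc])
  -- the integer `t_κ = (ϖ^d)⁻¹ · corner` of a frame and the three dictionaries
  have hdict : ∀ κ : unitaryGroupOfForm σ ((StdForm.antidiagonal 3).over K), κ ∈ unitaryInt σ ((StdForm.antidiagonal 3).over K) →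
      ∃ t₀ : 𝒪[K], (t₀ : K) = (ϖ ^ d)⁻¹ * B₀ σ 3 (((κ : GL (Fin 3) K) : Matrix (Fin 3) (Fin 3) K) *ᵥ (Pi.single 0 1))
          (((((u⁻¹ * γ * u : unitaryGroupOfForm σ ((StdForm.antidiagonal 3).over K)) : GL (Fin 3) K) : Matrix (Fin 3) (Fin 3) K) - 1) *ᵥ
            (((κ : GL (Fin 3) K) : Matrix (Fin 3) (Fin 3) K) *ᵥ (Pi.single 0 1))) ∧
        (∀ t : 𝒪[K], (t : K) = (ϖ ^ d)⁻¹ * B₀ σ 3 (((κ : GL (Fin 3) K) : Matrix (Fin 3) (Fin 3) K) *ᵥ (Pi.single 0 1))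
          (((((u⁻¹ * γ * u : unitaryGroupOfForm σ ((StdForm.antidiagonal 3).over K)) : GL (Fin 3) K) : Matrix (Fin 3) (Fin 3) K) - 1) *ᵥ
            (((κ : GL (Fin 3) K) : Matrix (Fin 3) (Fin 3) K) *ᵥ (Pi.single 0 1))) → t = t₀) ∧
        -- NULL ↔ residue 0
        ((Valued.v ((((((u * κ : unitaryGroupOfForm σ ((StdForm.antidiagonal 3).over K)) : GL (Fin 3) K)⁻¹ : GL (Fin 3) K) : Matrix (Fin 3) (Fin 3) K) *
          (((γ : GL (Fin 3) K) : Matrix (Fin 3) (Fin 3) K) - 1) * (((u * κ : unitaryGroupOfForm σ ((StdForm.antidiagonal 3).over K)) : GL (Fin 3) K) : Matrix (Fin 3) (Fin 3) K)) 2 0) ≤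
            Valued.v ϖ ^ (d + 1)) ↔ IsLocalRing.residue 𝒪[K] t₀ = 0) ∧
        -- line class `−c` ↔ `χ(−c̄ · t̄₀) = 1`
        ((∃ a₀ : K, Valued.v a₀ = 1 ∧ Valued.v ((ϖ ^ d)⁻¹ * ((((((u * κ : unitaryGroupOfForm σ ((StdForm.antidiagonal 3).over K)) : GL (Fin 3) K)⁻¹ : GL (Fin 3) K) : Matrix (Fin 3) (Fin 3) K) *
          (((γ : GL (Fin 3) K) : Matrix (Fin 3) (Fin 3) K) - 1) * (((u * κ : unitaryGroupOfForm σ ((StdForm.antidiagonal 3).over K)) : GL (Fin 3) K) : Matrix (Fin 3) (Fin 3) K)) 2 0) -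
          (-c) * a₀ ^ 2) < 1) ↔ quadraticChar 𝓀[K] (IsLocalRing.residue 𝒪[K] ⟨-c, hcO⟩ * IsLocalRing.residue 𝒪[K] t₀) = 1) := by
    intro κ hκ
    have hX : Valued.v ((((((u * κ : unitaryGroupOfForm σ ((StdForm.antidiagonal 3).over K)) : GL (Fin 3) K)⁻¹ : GL (Fin 3) K) : Matrix (Fin 3) (Fin 3) K) *
          (((γ : GL (Fin 3) K) : Matrix (Fin 3) (Fin 3) K) - 1) * (((u * κ : unitaryGroupOfForm σ ((StdForm.antidiagonal 3).over K)) : GL (Fin 3) K) : Matrix (Fin 3) (Fin 3) K)) 2 0) ≤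
        Valued.v ϖ ^ d := hMκ κ hκ 2 0
    have hint : (ϖ ^ d)⁻¹ * ((((((u * κ : unitaryGroupOfForm σ ((StdForm.antidiagonal 3).over K)) : GL (Fin 3) K)⁻¹ : GL (Fin 3) K) : Matrix (Fin 3) (Fin 3) K) *
          (((γ : GL (Fin 3) K) : Matrix (Fin 3) (Fin 3) K) - 1) * (((u * κ : unitaryGroupOfForm σ ((StdForm.antidiagonal 3).over K)) : GL (Fin 3) K) : Matrix (Fin 3) (Fin 3) K)) 2 0) ∈ 𝒪[K] := by
      refine (Valuation.mem_integer_iff _ _).2 ?_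
      rw [map_mul, map_inv₀, map_pow]
      have h' := mul_le_mul' (le_refl ((Valued.v ϖ ^ d)⁻¹)) hX
      rwa [inv_mul_cancel₀ (pow_ne_zero _ hvϖ0)] at h'
    refine ⟨⟨_, hint⟩, by rw [← hcorner], fun t ht => Subtype.ext (by rw [← hcorner] at ht; exact ht), ?_, ?_⟩
    · -- NULL ↔ residue 0
      rw [residue_eq_zero_iff_v_lt_one, v_lt_one_iff, ← hϖ]
      change _ ↔ Valued.v ((ϖ ^ d)⁻¹ * _) ≤ _
      rw [map_mul, map_inv₀, map_pow, pow_succ]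
      constructor
      · intro h
        have h' := mul_le_mul' (le_refl ((Valued.v ϖ ^ d)⁻¹)) h
        rwa [← mul_assoc, inv_mul_cancel₀ (pow_ne_zero _ hvϖ0), one_mul] at h'
      · intro h
        have h' := mul_le_mul' (le_refl (Valued.v ϖ ^ d)) h
        rwa [← mul_assoc, mul_inv_cancel₀ (pow_ne_zero _ hvϖ0), one_mul] at h'
    · -- class ↔ χ
      rw [← quadraticChar_mul_eq_one_iff_exists_sq hcres, ← exists_unit_v_sub_mul_sq_lt_one_iff_residue]
  -- ### the «lines through a child» dictionary: for a child `c′ = (uκ)·N₁` and the predicates `P₁ P₂ P₃`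
  -- every child passes (level ≥ 2), is not the parent, and has a grandchild through it
  have hpass : ∀ κ : unitaryGroupOfForm σ ((StdForm.antidiagonal 3).over K), κ ∈ unitaryInt σ ((StdForm.antidiagonal 3).over K) →
      ∀ w' ∈ (latticeGraph σ ϖ ((StdForm.antidiagonal 3).over K)).neighborSet (latticeGraphIso σ ϖ ((StdForm.antidiagonal 3).over K) (u * κ) N₁v),
        latticeGraphIso σ ϖ ((StdForm.antidiagonal 3).over K) γ w' = w' := fun κ hκ w' hw' =>
    forall_fixed_neighbor_of_congr_sq hvσ hσϖ hϖ hres hγK hκ hM2 hw'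
  have hexw : ∀ (κ : unitaryGroupOfForm σ ((StdForm.antidiagonal 3).over K)) (hκ : κ ∈ unitaryInt σ ((StdForm.antidiagonal 3).over K))
      (c' : {M : Submodule 𝒪[K] (Fin 3 → K) // IsVertex σ ϖ ((StdForm.antidiagonal 3).over K) M}),
      c' = latticeGraphIso σ ϖ ((StdForm.antidiagonal 3).over K) (u * κ) N₁v → (latticeGraph σ ϖ ((StdForm.antidiagonal 3).over K)).Adj v c' →
      (latticeGraph σ ϖ ((StdForm.antidiagonal 3).over K)).dist r c' = (latticeGraph σ ϖ ((StdForm.antidiagonal 3).over K)).dist r v + 1 →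
      ∃ w, (latticeGraph σ ϖ ((StdForm.antidiagonal 3).over K)).Adj c' w ∧
        (latticeGraph σ ϖ ((StdForm.antidiagonal 3).over K)).dist r w = (latticeGraph σ ϖ ((StdForm.antidiagonal 3).over K)).dist r c' + 1 ∧ w ≠ v := by
    intro κ hκ c' hcκ hvc hdc
    have hcard : ((latticeGraph σ ϖ ((StdForm.antidiagonal 3).over K)).neighborSet c').ncard = Nat.card 𝓀[K] + 1 := by
      rw [hcκ, ncard_neighborSet_latticeGraphIso, ncard_neighborSet_N₁_of_neg hvσ hσϖ hϖ hres]
    obtain ⟨w, hw, hwv⟩ := Set.exists_ne_of_one_lt_ncard (by rw [hcard]; omega) v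
    have hcr : c' ≠ r := by intro h; rw [h, SimpleGraph.dist_self] at hdc; omega
    have hcp' : par c' = v := (hchild v c' hvr hvc (hchild' c' hvc hdc ∘ fun h => h.trans hpv.symm)).2
    have hw' : (latticeGraph σ ϖ ((StdForm.antidiagonal 3).over K)).Adj c' w := (SimpleGraph.mem_neighborSet _ _ _).1 hw
    refine ⟨w, hw', (hchild c' w hcr hw' (by rw [hcp']; exact hwv)).1, hwv⟩
  -- ### the three set identities: children along which `Pᵢ` holds ↔ neighbours whose line passes `Tᵢ`
  -- the finite star of `v`
  have hfinv : ((latticeGraph σ ϖ ((StdForm.antidiagonal 3).over K)).neighborSet v).Finite := by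
    refine Set.finite_of_ncard_ne_zero ?_
    rw [hvdef, ncard_neighborSet_latticeGraphIso, ncard_neighborSet_root_of_ramified hσ hvσ hϖ hres h2 (isVertexLattice_two_N₁_of_neg hσϖ hϖ)]
    exact Nat.succ_ne_zero _
  -- generic comparison: a «child set cut by a per-line condition» against a «neighbour set cut by a residue condition on t»
  have hSet : ∀ (P : {M : Submodule 𝒪[K] (Fin 3 → K) // IsVertex σ ϖ ((StdForm.antidiagonal 3).over K) M} → Prop) (T : 𝓀[K] → Prop),
      -- (A) in any K₀-frame of a NON-PARENT neighbour: `T(t̄)` ⇒ `P` at every vertex adjacent to it other than `v`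
      (∀ (κ : unitaryGroupOfForm σ ((StdForm.antidiagonal 3).over K)) (hκ : κ ∈ unitaryInt σ ((StdForm.antidiagonal 3).over K))
        (c' w : {M : Submodule 𝒪[K] (Fin 3 → K) // IsVertex σ ϖ ((StdForm.antidiagonal 3).over K) M}),
        c' = latticeGraphIso σ ϖ ((StdForm.antidiagonal 3).over K) (u * κ) N₁v → c' ≠ p →
        (latticeGraph σ ϖ ((StdForm.antidiagonal 3).over K)).Adj c' w → w ≠ v →
        (∀ t : 𝒪[K], (t : K) = (ϖ ^ d)⁻¹ * B₀ σ 3 (((κ : GL (Fin 3) K) : Matrix (Fin 3) (Fin 3) K) *ᵥ (Pi.single 0 1))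
          (((((u⁻¹ * γ * u : unitaryGroupOfForm σ ((StdForm.antidiagonal 3).over K)) : GL (Fin 3) K) : Matrix (Fin 3) (Fin 3) K) - 1) *ᵥ
            (((κ : GL (Fin 3) K) : Matrix (Fin 3) (Fin 3) K) *ᵥ (Pi.single 0 1))) → (T (IsLocalRing.residue 𝒪[K] t) ↔ P w))) →
      -- (B) the parent fails `T`
      (∀ (κ : unitaryGroupOfForm σ ((StdForm.antidiagonal 3).over K)), κ ∈ unitaryInt σ ((StdForm.antidiagonal 3).over K) →
        p = latticeGraphIso σ ϖ ((StdForm.antidiagonal 3).over K) (u * κ) N₁v →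
        ∀ t : 𝒪[K], (t : K) = (ϖ ^ d)⁻¹ * B₀ σ 3 (((κ : GL (Fin 3) K) : Matrix (Fin 3) (Fin 3) K) *ᵥ (Pi.single 0 1))
          (((((u⁻¹ * γ * u : unitaryGroupOfForm σ ((StdForm.antidiagonal 3).over K)) : GL (Fin 3) K) : Matrix (Fin 3) (Fin 3) K) - 1) *ᵥ
            (((κ : GL (Fin 3) K) : Matrix (Fin 3) (Fin 3) K) *ᵥ (Pi.single 0 1))) → ¬ T (IsLocalRing.residue 𝒪[K] t)) →
      {c' | (latticeGraph σ ϖ ((StdForm.antidiagonal 3).over K)).Adj v c' ∧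
          (latticeGraph σ ϖ ((StdForm.antidiagonal 3).over K)).dist r c' = (latticeGraph σ ϖ ((StdForm.antidiagonal 3).over K)).dist r v + 1 ∧
          (∀ w ∈ (latticeGraph σ ϖ ((StdForm.antidiagonal 3).over K)).neighborSet c', latticeGraphIso σ ϖ ((StdForm.antidiagonal 3).over K) γ w = w) ∧
          ∀ w, (latticeGraph σ ϖ ((StdForm.antidiagonal 3).over K)).Adj c' w →
            (latticeGraph σ ϖ ((StdForm.antidiagonal 3).over K)).dist r w = (latticeGraph σ ϖ ((StdForm.antidiagonal 3).over K)).dist r c' + 1 → P w} =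
      {c' | c' ∈ (latticeGraph σ ϖ ((StdForm.antidiagonal 3).over K)).neighborSet v ∧
          ∃ κ : unitaryGroupOfForm σ ((StdForm.antidiagonal 3).over K), κ ∈ unitaryInt σ ((StdForm.antidiagonal 3).over K) ∧
            c'.1 = mapGL (((u * κ : unitaryGroupOfForm σ ((StdForm.antidiagonal 3).over K)) : GL (Fin 3) K)) (latt (Matrix.diagonal ![(1 : K), 1, ϖ])) ∧
            ∃ t : 𝒪[K], (t : K) = (ϖ ^ d)⁻¹ * B₀ σ 3 (((κ : GL (Fin 3) K) : Matrix (Fin 3) (Fin 3) K) *ᵥ (Pi.single 0 1))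
              (((((u⁻¹ * γ * u : unitaryGroupOfForm σ ((StdForm.antidiagonal 3).over K)) : GL (Fin 3) K) : Matrix (Fin 3) (Fin 3) K) - 1) *ᵥ
                (((κ : GL (Fin 3) K) : Matrix (Fin 3) (Fin 3) K) *ᵥ (Pi.single 0 1))) ∧ T (IsLocalRing.residue 𝒪[K] t)} := by
    intro P T hA hB
    ext c'
    simp only [Set.mem_setOf_eq, SimpleGraph.mem_neighborSet]
    constructor
    · rintro ⟨hvc, hdc, -, hall⟩
      obtain ⟨κ, hκ, hcκ⟩ := hframe c' hvc
      obtain ⟨t₀, ht₀, -, -, -⟩ := hdict κ hκ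
      have hcp := hchild' c' hvc hdc
      obtain ⟨w, hcw, hdw, hwv⟩ := hexw κ hκ c' hcκ hvc hdc
      refine ⟨hvc, κ, hκ, by rw [hcκ, latticeGraphIso_apply_val], t₀, ht₀, ?_⟩
      exact (hA κ hκ c' w hcκ hcp hcw hwv t₀ ht₀).2 (hall w hcw hdw)
    · rintro ⟨hvc, κ, hκ, hcκ1, t, ht, hTt⟩
      have hcκ : c' = latticeGraphIso σ ϖ ((StdForm.antidiagonal 3).over K) (u * κ) N₁v := Subtype.ext (by rw [latticeGraphIso_apply_val]; exact hcκ1)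
      have hcp : c' ≠ p := fun h => hB κ hκ (h ▸ hcκ) t ht hTt
      have hdc : (latticeGraph σ ϖ ((StdForm.antidiagonal 3).over K)).dist r c' = (latticeGraph σ ϖ ((StdForm.antidiagonal 3).over K)).dist r v + 1 :=
        (hchild v c' hvr hvc (fun h => hcp (h.trans hpv.symm))).1
      refine ⟨hvc, hdc, fun w hw => hpass κ hκ w (by rw [← hcκ]; exact hw), fun w hcw hdw => ?_⟩
      have hwv : w ≠ v := by intro h; rw [h] at hdw; omega
      exact (hA κ hκ c' w hcκ hcp hcw hwv t ht).1 hTt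
  -- the same with a PARENT THAT PASSES `T`: then the parent is the one extra neighbour
  have hSetPar : ∀ (P : {M : Submodule 𝒪[K] (Fin 3 → K) // IsVertex σ ϖ ((StdForm.antidiagonal 3).over K) M} → Prop) (T : 𝓀[K] → Prop),
      (∀ (κ : unitaryGroupOfForm σ ((StdForm.antidiagonal 3).over K)) (hκ : κ ∈ unitaryInt σ ((StdForm.antidiagonal 3).over K)) (c' w : {M : Submodule 𝒪[K] (Fin 3 → K) // IsVertex σ ϖ ((StdForm.antidiagonal 3).over K) M}),
        c' = latticeGraphIso σ ϖ ((StdForm.antidiagonal 3).over K) (u * κ) N₁v → c' ≠ p →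
        (latticeGraph σ ϖ ((StdForm.antidiagonal 3).over K)).Adj c' w → w ≠ v →
        (∀ t : 𝒪[K], (t : K) = (ϖ ^ d)⁻¹ * B₀ σ 3 (((κ : GL (Fin 3) K) : Matrix (Fin 3) (Fin 3) K) *ᵥ (Pi.single 0 1))
          (((((u⁻¹ * γ * u : unitaryGroupOfForm σ ((StdForm.antidiagonal 3).over K)) : GL (Fin 3) K) : Matrix (Fin 3) (Fin 3) K) - 1) *ᵥ
            (((κ : GL (Fin 3) K) : Matrix (Fin 3) (Fin 3) K) *ᵥ (Pi.single 0 1))) → (T (IsLocalRing.residue 𝒪[K] t) ↔ P w))) →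
      (∀ (κ : unitaryGroupOfForm σ ((StdForm.antidiagonal 3).over K)), κ ∈ unitaryInt σ ((StdForm.antidiagonal 3).over K) →
        p = latticeGraphIso σ ϖ ((StdForm.antidiagonal 3).over K) (u * κ) N₁v →
        ∀ t : 𝒪[K], (t : K) = (ϖ ^ d)⁻¹ * B₀ σ 3 (((κ : GL (Fin 3) K) : Matrix (Fin 3) (Fin 3) K) *ᵥ (Pi.single 0 1))
          (((((u⁻¹ * γ * u : unitaryGroupOfForm σ ((StdForm.antidiagonal 3).over K)) : GL (Fin 3) K) : Matrix (Fin 3) (Fin 3) K) - 1) *ᵥ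
            (((κ : GL (Fin 3) K) : Matrix (Fin 3) (Fin 3) K) *ᵥ (Pi.single 0 1))) → T (IsLocalRing.residue 𝒪[K] t)) →
      ({c' | (latticeGraph σ ϖ ((StdForm.antidiagonal 3).over K)).Adj v c' ∧
          (latticeGraph σ ϖ ((StdForm.antidiagonal 3).over K)).dist r c' = (latticeGraph σ ϖ ((StdForm.antidiagonal 3).over K)).dist r v + 1 ∧
          (∀ w ∈ (latticeGraph σ ϖ ((StdForm.antidiagonal 3).over K)).neighborSet c', latticeGraphIso σ ϖ ((StdForm.antidiagonal 3).over K) γ w = w) ∧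
          ∀ w, (latticeGraph σ ϖ ((StdForm.antidiagonal 3).over K)).Adj c' w →
            (latticeGraph σ ϖ ((StdForm.antidiagonal 3).over K)).dist r w = (latticeGraph σ ϖ ((StdForm.antidiagonal 3).over K)).dist r c' + 1 → P w}).ncard + 1 =
      ({c' | c' ∈ (latticeGraph σ ϖ ((StdForm.antidiagonal 3).over K)).neighborSet v ∧
          ∃ κ : unitaryGroupOfForm σ ((StdForm.antidiagonal 3).over K), κ ∈ unitaryInt σ ((StdForm.antidiagonal 3).over K) ∧
            c'.1 = mapGL (((u * κ : unitaryGroupOfForm σ ((StdForm.antidiagonal 3).over K)) : GL (Fin 3) K)) (latt (Matrix.diagonal ![(1 : K), 1, ϖ])) ∧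
            ∃ t : 𝒪[K], (t : K) = (ϖ ^ d)⁻¹ * B₀ σ 3 (((κ : GL (Fin 3) K) : Matrix (Fin 3) (Fin 3) K) *ᵥ (Pi.single 0 1))
          (((((u⁻¹ * γ * u : unitaryGroupOfForm σ ((StdForm.antidiagonal 3).over K)) : GL (Fin 3) K) : Matrix (Fin 3) (Fin 3) K) - 1) *ᵥ
            (((κ : GL (Fin 3) K) : Matrix (Fin 3) (Fin 3) K) *ᵥ (Pi.single 0 1))) ∧ T (IsLocalRing.residue 𝒪[K] t)}).ncard := by
    intro P T hA hB
    have hSeq : insert p {c' | (latticeGraph σ ϖ ((StdForm.antidiagonal 3).over K)).Adj v c' ∧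
          (latticeGraph σ ϖ ((StdForm.antidiagonal 3).over K)).dist r c' = (latticeGraph σ ϖ ((StdForm.antidiagonal 3).over K)).dist r v + 1 ∧
          (∀ w ∈ (latticeGraph σ ϖ ((StdForm.antidiagonal 3).over K)).neighborSet c', latticeGraphIso σ ϖ ((StdForm.antidiagonal 3).over K) γ w = w) ∧
          ∀ w, (latticeGraph σ ϖ ((StdForm.antidiagonal 3).over K)).Adj c' w →
            (latticeGraph σ ϖ ((StdForm.antidiagonal 3).over K)).dist r w = (latticeGraph σ ϖ ((StdForm.antidiagonal 3).over K)).dist r c' + 1 → P w} =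
        {c' | c' ∈ (latticeGraph σ ϖ ((StdForm.antidiagonal 3).over K)).neighborSet v ∧
          ∃ κ : unitaryGroupOfForm σ ((StdForm.antidiagonal 3).over K), κ ∈ unitaryInt σ ((StdForm.antidiagonal 3).over K) ∧
            c'.1 = mapGL (((u * κ : unitaryGroupOfForm σ ((StdForm.antidiagonal 3).over K)) : GL (Fin 3) K)) (latt (Matrix.diagonal ![(1 : K), 1, ϖ])) ∧
            ∃ t : 𝒪[K], (t : K) = (ϖ ^ d)⁻¹ * B₀ σ 3 (((κ : GL (Fin 3) K) : Matrix (Fin 3) (Fin 3) K) *ᵥ (Pi.single 0 1))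
          (((((u⁻¹ * γ * u : unitaryGroupOfForm σ ((StdForm.antidiagonal 3).over K)) : GL (Fin 3) K) : Matrix (Fin 3) (Fin 3) K) - 1) *ᵥ
            (((κ : GL (Fin 3) K) : Matrix (Fin 3) (Fin 3) K) *ᵥ (Pi.single 0 1))) ∧ T (IsLocalRing.residue 𝒪[K] t)} := by
      ext c'
      simp only [Set.mem_insert_iff, Set.mem_setOf_eq, SimpleGraph.mem_neighborSet]
      constructor
      · rintro (hcp | ⟨hvc, hdc, -, hall⟩)
        · subst hcp
          obtain ⟨κ, hκ, hcκ⟩ := hframe _ hp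
          obtain ⟨t₀, ht₀, -, -, -⟩ := hdict κ hκ
          exact ⟨hp, κ, hκ, by rw [hcκ, latticeGraphIso_apply_val], t₀, ht₀, hB κ hκ hcκ t₀ ht₀⟩
        · obtain ⟨κ, hκ, hcκ⟩ := hframe c' hvc
          obtain ⟨t₀, ht₀, -, -, -⟩ := hdict κ hκ
          have hcp := hchild' c' hvc hdc
          obtain ⟨w, hcw, hdw, hwv⟩ := hexw κ hκ c' hcκ hvc hdc
          exact ⟨hvc, κ, hκ, by rw [hcκ, latticeGraphIso_apply_val], t₀, ht₀, (hA κ hκ c' w hcκ hcp hcw hwv t₀ ht₀).2 (hall w hcw hdw)⟩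
      · rintro ⟨hvc, κ, hκ, hcκ1, t, ht, hTt⟩
        by_cases hcp : c' = p
        · exact Or.inl hcp
        · right
          have hcκ : c' = latticeGraphIso σ ϖ ((StdForm.antidiagonal 3).over K) (u * κ) N₁v := Subtype.ext (by rw [latticeGraphIso_apply_val]; exact hcκ1)
          have hdc : (latticeGraph σ ϖ ((StdForm.antidiagonal 3).over K)).dist r c' = (latticeGraph σ ϖ ((StdForm.antidiagonal 3).over K)).dist r v + 1 := (hchild v c' hvr hvc (fun h => hcp (h.trans hpv.symm))).1
          refine ⟨hvc, hdc, fun w hw => hpass κ hκ w (by rw [← hcκ]; exact hw), fun w hcw hdw => ?_⟩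
          have hwv : w ≠ v := by intro h; rw [h] at hdw; omega
          exact (hA κ hκ c' w hcκ hcp hcw hwv t ht).1 hTt
    have hnot : p ∉ {c' | (latticeGraph σ ϖ ((StdForm.antidiagonal 3).over K)).Adj v c' ∧
          (latticeGraph σ ϖ ((StdForm.antidiagonal 3).over K)).dist r c' = (latticeGraph σ ϖ ((StdForm.antidiagonal 3).over K)).dist r v + 1 ∧
          (∀ w ∈ (latticeGraph σ ϖ ((StdForm.antidiagonal 3).over K)).neighborSet c', latticeGraphIso σ ϖ ((StdForm.antidiagonal 3).over K) γ w = w) ∧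
          ∀ w, (latticeGraph σ ϖ ((StdForm.antidiagonal 3).over K)).Adj c' w →
            (latticeGraph σ ϖ ((StdForm.antidiagonal 3).over K)).dist r w = (latticeGraph σ ϖ ((StdForm.antidiagonal 3).over K)).dist r c' + 1 → P w} := by
      rintro ⟨-, hdc, -, -⟩
      omega
    have hfinC : ({c' | (latticeGraph σ ϖ ((StdForm.antidiagonal 3).over K)).Adj v c' ∧
          (latticeGraph σ ϖ ((StdForm.antidiagonal 3).over K)).dist r c' = (latticeGraph σ ϖ ((StdForm.antidiagonal 3).over K)).dist r v + 1 ∧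
          (∀ w ∈ (latticeGraph σ ϖ ((StdForm.antidiagonal 3).over K)).neighborSet c', latticeGraphIso σ ϖ ((StdForm.antidiagonal 3).over K) γ w = w) ∧
          ∀ w, (latticeGraph σ ϖ ((StdForm.antidiagonal 3).over K)).Adj c' w →
            (latticeGraph σ ϖ ((StdForm.antidiagonal 3).over K)).dist r w = (latticeGraph σ ϖ ((StdForm.antidiagonal 3).over K)).dist r c' + 1 → P w}).Finite :=
      hfinv.subset (fun c' hc' => (SimpleGraph.mem_neighborSet _ _ _).2 hc'.1)
    rw [← hSeq, Set.ncard_insert_of_notMem hnot hfinC]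
  -- ### the residual datum and the line counts (★ G3⁵)
  have hnullcount := ncard_neighborSet_null_eq_two_of_tokens hσ hvσ hσϖ hϖ hres h2 γ u hd hlev hrk hnil
  have hcls1 := two_mul_ncard_neighborSet_quadraticChar_eq_of_tokens hσ hvσ hσϖ hϖ hres h2 γ u hd hlev hrk hnil hcres (s := 1) (Or.inl rfl)
  have hcls2 := two_mul_ncard_neighborSet_quadraticChar_eq_of_tokens hσ hvσ hσϖ hϖ hres h2 γ u hd hlev hrk hnil hcres (s := -1) (Or.inr rfl)
  -- ### (A)-lemmas for the three predicates
  -- P₁: the `(d−1)`-grandchildren ↔ NULL lines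
  have hA1 : ∀ (κ : unitaryGroupOfForm σ ((StdForm.antidiagonal 3).over K)) (hκ : κ ∈ unitaryInt σ ((StdForm.antidiagonal 3).over K))
      (c' w : {M : Submodule 𝒪[K] (Fin 3 → K) // IsVertex σ ϖ ((StdForm.antidiagonal 3).over K) M}),
      c' = latticeGraphIso σ ϖ ((StdForm.antidiagonal 3).over K) (u * κ) N₁v → c' ≠ p →
      (latticeGraph σ ϖ ((StdForm.antidiagonal 3).over K)).Adj c' w → w ≠ v →
      ∀ t : 𝒪[K], (t : K) = (ϖ ^ d)⁻¹ * B₀ σ 3 (((κ : GL (Fin 3) K) : Matrix (Fin 3) (Fin 3) K) *ᵥ (Pi.single 0 1))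
        (((((u⁻¹ * γ * u : unitaryGroupOfForm σ ((StdForm.antidiagonal 3).over K)) : GL (Fin 3) K) : Matrix (Fin 3) (Fin 3) K) - 1) *ᵥ
          (((κ : GL (Fin 3) K) : Matrix (Fin 3) (Fin 3) K) *ᵥ (Pi.single 0 1))) →
      (IsLocalRing.residue 𝒪[K] t = 0 ↔
        (w.1.map ((Matrix.toLin' (((γ : GL (Fin 3) K) : Matrix (Fin 3) (Fin 3) K) - 1)).restrictScalars 𝒪[K]) ≤ scaleLattice (ϖ ^ (d - 1)) w.1 ∧
          ¬ w.1.map ((Matrix.toLin' (((γ : GL (Fin 3) K) : Matrix (Fin 3) (Fin 3) K) - 1)).restrictScalars 𝒪[K]) ≤ scaleLattice (ϖ ^ d) w.1)) := by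
    intro κ hκ c' w hcκ hcp hcw hwv t ht
    obtain ⟨t₀, -, huniq, hnull, -⟩ := hdict κ hκ
    rw [huniq t ht, ← hnull]
    constructor
    · intro h20
      have h := hnullLab κ hκ c' w hcκ hcp hcw hwv h20
      exact ⟨h.1, h.2.1⟩
    · rintro ⟨hle, -⟩
      by_contra h20
      exact (hclassLab κ hκ c' w hcκ hcw hwv h20).1.2.1 hle
  -- P₂ ∕ P₃: the `(d−2)`-grandchildren of class `c` ∕ not `c` ↔ NON-NULL lines of class `−c` ∕ not `−c`
  have hA23 : ∀ (κ : unitaryGroupOfForm σ ((StdForm.antidiagonal 3).over K)) (hκ : κ ∈ unitaryInt σ ((StdForm.antidiagonal 3).over K))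
      (c' w : {M : Submodule 𝒪[K] (Fin 3 → K) // IsVertex σ ϖ ((StdForm.antidiagonal 3).over K) M}),
      c' = latticeGraphIso σ ϖ ((StdForm.antidiagonal 3).over K) (u * κ) N₁v → c' ≠ p →
      (latticeGraph σ ϖ ((StdForm.antidiagonal 3).over K)).Adj c' w → w ≠ v →
      ∀ t : 𝒪[K], (t : K) = (ϖ ^ d)⁻¹ * B₀ σ 3 (((κ : GL (Fin 3) K) : Matrix (Fin 3) (Fin 3) K) *ᵥ (Pi.single 0 1))
        (((((u⁻¹ * γ * u : unitaryGroupOfForm σ ((StdForm.antidiagonal 3).over K)) : GL (Fin 3) K) : Matrix (Fin 3) (Fin 3) K) - 1) *ᵥ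
          (((κ : GL (Fin 3) K) : Matrix (Fin 3) (Fin 3) K) *ᵥ (Pi.single 0 1))) →
      ((IsLocalRing.residue 𝒪[K] t ≠ 0 ↔
        (w.1.map ((Matrix.toLin' (((γ : GL (Fin 3) K) : Matrix (Fin 3) (Fin 3) K) - 1)).restrictScalars 𝒪[K]) ≤ scaleLattice (ϖ ^ (d - 2)) w.1 ∧
          ¬ w.1.map ((Matrix.toLin' (((γ : GL (Fin 3) K) : Matrix (Fin 3) (Fin 3) K) - 1)).restrictScalars 𝒪[K]) ≤ scaleLattice (ϖ ^ (d - 1)) w.1)) ∧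
      (IsLocalRing.residue 𝒪[K] t ≠ 0 →
        (quadraticChar 𝓀[K] (IsLocalRing.residue 𝒪[K] ⟨-c, hcO⟩ * IsLocalRing.residue 𝒪[K] t) = 1 ↔
          ∃ y ∈ w.1, ∃ a' : K, Valued.v a' = 1 ∧
            Valued.v ((ϖ ^ (d - 2))⁻¹ * pairing σ ((StdForm.antidiagonal 3).over K) y ((((γ : GL (Fin 3) K) : Matrix (Fin 3) (Fin 3) K) - 1) *ᵥ y) - c * a' ^ 2) < 1))) := by
    intro κ hκ c' w hcκ hcp hcw hwv t ht
    obtain ⟨t₀, -, huniq, hnull, hcls⟩ := hdict κ hκ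
    rw [huniq t ht]
    refine ⟨?_, fun hne => ?_⟩
    · rw [Ne, ← hnull]
      constructor
      · intro h20
        have h := (hclassLab κ hκ c' w hcκ hcw hwv h20).1
        exact ⟨h.1, h.2.1⟩
      · rintro ⟨-, hnot⟩ h20
        exact hnot (hnullLab κ hκ c' w hcκ hcp hcw hwv h20).1
    · have h20 : ¬ _ := fun h20 => hne (hnull.1 h20)
      rw [← hcls, (hclassLab κ hκ c' w hcκ hcw hwv h20).2 c hc]
  -- ### (B): the parent's line is NULL, so it fails every class test and passes the null test
  have hBpar : ∀ (κ : unitaryGroupOfForm σ ((StdForm.antidiagonal 3).over K)), κ ∈ unitaryInt σ ((StdForm.antidiagonal 3).over K) →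
      p = latticeGraphIso σ ϖ ((StdForm.antidiagonal 3).over K) (u * κ) N₁v →
      ∀ t : 𝒪[K], (t : K) = (ϖ ^ d)⁻¹ * B₀ σ 3 (((κ : GL (Fin 3) K) : Matrix (Fin 3) (Fin 3) K) *ᵥ (Pi.single 0 1))
        (((((u⁻¹ * γ * u : unitaryGroupOfForm σ ((StdForm.antidiagonal 3).over K)) : GL (Fin 3) K) : Matrix (Fin 3) (Fin 3) K) - 1) *ᵥ
          (((κ : GL (Fin 3) K) : Matrix (Fin 3) (Fin 3) K) *ᵥ (Pi.single 0 1))) → IsLocalRing.residue 𝒪[K] t = 0 := by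
    intro κ hκ hpκ t ht
    obtain ⟨t₀, -, huniq, hnull, -⟩ := hdict κ hκ
    rw [huniq t ht]
    exact hnull.1 (hparnull κ hκ hpκ)
  -- ### conjunct (i): the label dichotomy of every fixed grandchild
  refine ⟨?_, ?_, ?_, ?_⟩
  · rintro w ⟨c', ⟨hvc, hdc, -⟩, hcw, hdw, -⟩
    obtain ⟨κ, hκ, hcκ⟩ := hframe c' hvc
    have hwv : w ≠ v := by intro h; rw [h] at hdw; omega
    by_cases h20 : Valued.v ((((((u * κ : unitaryGroupOfForm σ ((StdForm.antidiagonal 3).over K)) : GL (Fin 3) K)⁻¹ : GL (Fin 3) K) : Matrix (Fin 3) (Fin 3) K) *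
          (((γ : GL (Fin 3) K) : Matrix (Fin 3) (Fin 3) K) - 1) * (((u * κ : unitaryGroupOfForm σ ((StdForm.antidiagonal 3).over K)) : GL (Fin 3) K) : Matrix (Fin 3) (Fin 3) K)) 2 0) ≤
          Valued.v ϖ ^ (d + 1)
    · exact Or.inl (hnullLab κ hκ c' w hcκ (hchild' c' hvc hdc) hcw hwv h20)
    · exact Or.inr (hclassLab κ hκ c' w hcκ hcw hwv h20).1
  · -- ### conjunct (ii): `#{(d−1)-grandchildren} = q · #{null outward lines} = q · (2 − 1)`
    -- slice constancy and the child set through (A1)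
    have hA : ∀ (κ : unitaryGroupOfForm σ ((StdForm.antidiagonal 3).over K)) (hκ : κ ∈ unitaryInt σ ((StdForm.antidiagonal 3).over K)) (c' w : {M : Submodule 𝒪[K] (Fin 3 → K) // IsVertex σ ϖ ((StdForm.antidiagonal 3).over K) M}),
        c' = latticeGraphIso σ ϖ ((StdForm.antidiagonal 3).over K) (u * κ) N₁v → c' ≠ p → (latticeGraph σ ϖ ((StdForm.antidiagonal 3).over K)).Adj c' w → w ≠ v →
        ∀ t : 𝒪[K], (t : K) = (ϖ ^ d)⁻¹ * B₀ σ 3 (((κ : GL (Fin 3) K) : Matrix (Fin 3) (Fin 3) K) *ᵥ (Pi.single 0 1))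
          (((((u⁻¹ * γ * u : unitaryGroupOfForm σ ((StdForm.antidiagonal 3).over K)) : GL (Fin 3) K) : Matrix (Fin 3) (Fin 3) K) - 1) *ᵥ
            (((κ : GL (Fin 3) K) : Matrix (Fin 3) (Fin 3) K) *ᵥ (Pi.single 0 1))) → (IsLocalRing.residue 𝒪[K] t = 0 ↔ (w.1.map ((Matrix.toLin' (((γ : GL (Fin 3) K) : Matrix (Fin 3) (Fin 3) K) - 1)).restrictScalars 𝒪[K]) ≤ scaleLattice (ϖ ^ (d - 1)) w.1 ∧
          ¬ w.1.map ((Matrix.toLin' (((γ : GL (Fin 3) K) : Matrix (Fin 3) (Fin 3) K) - 1)).restrictScalars 𝒪[K]) ≤ scaleLattice (ϖ ^ (d)) w.1)) :=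
      fun κ hκ c' w hcκ hcp hcw hwv t ht => hA1 κ hκ c' w hcκ hcp hcw hwv t ht
    rw [ncard_fixedGrandchildren_sep_eq_mul_ncard_passingChildren hσ hvσ hσϖ hϖ hres h2 hT hvS hvr hfix hlev1 _ (by
      intro c' hvc hdc w w' hcw hdw hcw' hdw'
      obtain ⟨κ, hκ, hcκ⟩ := hframe c' hvc
      obtain ⟨t₀, ht₀, -, -, -⟩ := hdict κ hκ
      have hcp := hchild' c' hvc hdc
      have hwv : w ≠ v := by intro h; rw [h] at hdw; omega
      have hwv' : w' ≠ v := by intro h; rw [h] at hdw'; omega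
      rw [← hA κ hκ c' w hcκ hcp hcw hwv t₀ ht₀, ← hA κ hκ c' w' hcκ hcp hcw' hwv' t₀ ht₀])]
    -- the child set plus the parent = the neighbours with a NULL line: `# + 1 = 2`
    have hcnt := hSetPar _ (fun t' => t' = 0) hA (fun κ hκ hpκ t ht => (hBpar κ hκ hpκ t ht : IsLocalRing.residue 𝒪[K] t = 0))
    have h2 : ({c' | c' ∈ (latticeGraph σ ϖ ((StdForm.antidiagonal 3).over K)).neighborSet v ∧
          ∃ κ : unitaryGroupOfForm σ ((StdForm.antidiagonal 3).over K), κ ∈ unitaryInt σ ((StdForm.antidiagonal 3).over K) ∧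
            c'.1 = mapGL (((u * κ : unitaryGroupOfForm σ ((StdForm.antidiagonal 3).over K)) : GL (Fin 3) K)) (latt (Matrix.diagonal ![(1 : K), 1, ϖ])) ∧
            ∃ t : 𝒪[K], (t : K) = (ϖ ^ d)⁻¹ * B₀ σ 3 (((κ : GL (Fin 3) K) : Matrix (Fin 3) (Fin 3) K) *ᵥ (Pi.single 0 1))
          (((((u⁻¹ * γ * u : unitaryGroupOfForm σ ((StdForm.antidiagonal 3).over K)) : GL (Fin 3) K) : Matrix (Fin 3) (Fin 3) K) - 1) *ᵥ
            (((κ : GL (Fin 3) K) : Matrix (Fin 3) (Fin 3) K) *ᵥ (Pi.single 0 1))) ∧ IsLocalRing.residue 𝒪[K] t = 0}).ncard = 2 := hnullcount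
    rw [h2] at hcnt
    have hone : ({c' | (latticeGraph σ ϖ ((StdForm.antidiagonal 3).over K)).Adj v c' ∧
          (latticeGraph σ ϖ ((StdForm.antidiagonal 3).over K)).dist r c' = (latticeGraph σ ϖ ((StdForm.antidiagonal 3).over K)).dist r v + 1 ∧
          (∀ w ∈ (latticeGraph σ ϖ ((StdForm.antidiagonal 3).over K)).neighborSet c', latticeGraphIso σ ϖ ((StdForm.antidiagonal 3).over K) γ w = w) ∧
          ∀ w, (latticeGraph σ ϖ ((StdForm.antidiagonal 3).over K)).Adj c' w →
            (latticeGraph σ ϖ ((StdForm.antidiagonal 3).over K)).dist r w = (latticeGraph σ ϖ ((StdForm.antidiagonal 3).over K)).dist r c' + 1 → (w.1.map ((Matrix.toLin' (((γ : GL (Fin 3) K) : Matrix (Fin 3) (Fin 3) K) - 1)).restrictScalars 𝒪[K]) ≤ scaleLattice (ϖ ^ (d - 1)) w.1 ∧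
          ¬ w.1.map ((Matrix.toLin' (((γ : GL (Fin 3) K) : Matrix (Fin 3) (Fin 3) K) - 1)).restrictScalars 𝒪[K]) ≤ scaleLattice (ϖ ^ (d)) w.1)}).ncard = 1 := by omega
    rw [hone, mul_one]
  · -- ### conjunct (iii): `#{(d−2)-grandchildren of class c} = q · #{lines of class −c} = q · (q−1)∕2`
    have hA : ∀ (κ : unitaryGroupOfForm σ ((StdForm.antidiagonal 3).over K)) (hκ : κ ∈ unitaryInt σ ((StdForm.antidiagonal 3).over K)) (c' w : {M : Submodule 𝒪[K] (Fin 3 → K) // IsVertex σ ϖ ((StdForm.antidiagonal 3).over K) M}),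
        c' = latticeGraphIso σ ϖ ((StdForm.antidiagonal 3).over K) (u * κ) N₁v → c' ≠ p → (latticeGraph σ ϖ ((StdForm.antidiagonal 3).over K)).Adj c' w → w ≠ v →
        ∀ t : 𝒪[K], (t : K) = (ϖ ^ d)⁻¹ * B₀ σ 3 (((κ : GL (Fin 3) K) : Matrix (Fin 3) (Fin 3) K) *ᵥ (Pi.single 0 1))
          (((((u⁻¹ * γ * u : unitaryGroupOfForm σ ((StdForm.antidiagonal 3).over K)) : GL (Fin 3) K) : Matrix (Fin 3) (Fin 3) K) - 1) *ᵥ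
            (((κ : GL (Fin 3) K) : Matrix (Fin 3) (Fin 3) K) *ᵥ (Pi.single 0 1))) → (quadraticChar 𝓀[K] (IsLocalRing.residue 𝒪[K] ⟨-c, hcO⟩ * IsLocalRing.residue 𝒪[K] t) = 1 ↔ ((w.1.map ((Matrix.toLin' (((γ : GL (Fin 3) K) : Matrix (Fin 3) (Fin 3) K) - 1)).restrictScalars 𝒪[K]) ≤ scaleLattice (ϖ ^ (d - 2)) w.1 ∧
          ¬ w.1.map ((Matrix.toLin' (((γ : GL (Fin 3) K) : Matrix (Fin 3) (Fin 3) K) - 1)).restrictScalars 𝒪[K]) ≤ scaleLattice (ϖ ^ (d - 1)) w.1) ∧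
        (∃ y ∈ w.1, ∃ a' : K, Valued.v a' = 1 ∧
            Valued.v ((ϖ ^ (d - 2))⁻¹ * pairing σ ((StdForm.antidiagonal 3).over K) y ((((γ : GL (Fin 3) K) : Matrix (Fin 3) (Fin 3) K) - 1) *ᵥ y) - c * a' ^ 2) < 1))) := by
      intro κ hκ c' w hcκ hcp hcw hwv t ht
      obtain ⟨hne, hcls⟩ := hA23 κ hκ c' w hcκ hcp hcw hwv t ht
      constructor
      · intro h1
        have ht0 : IsLocalRing.residue 𝒪[K] t ≠ 0 := fun h0 => by
          rw [h0, mul_zero, quadraticChar_zero] at h1; exact zero_ne_one h1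
        exact ⟨hne.1 ht0, (hcls ht0).1 h1⟩
      · rintro ⟨hlab, hcl⟩
        have ht0 := hne.2 hlab
        exact (hcls ht0).2 hcl
    rw [ncard_fixedGrandchildren_sep_eq_mul_ncard_passingChildren hσ hvσ hσϖ hϖ hres h2 hT hvS hvr hfix hlev1 _ (by
      intro c' hvc hdc w w' hcw hdw hcw' hdw'
      obtain ⟨κ, hκ, hcκ⟩ := hframe c' hvc
      obtain ⟨t₀, ht₀, -, -, -⟩ := hdict κ hκ
      have hcp := hchild' c' hvc hdc
      have hwv : w ≠ v := by intro h; rw [h] at hdw; omega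
      have hwv' : w' ≠ v := by intro h; rw [h] at hdw'; omega
      rw [← hA κ hκ c' w hcκ hcp hcw hwv t₀ ht₀, ← hA κ hκ c' w' hcκ hcp hcw' hwv' t₀ ht₀]),
      hSet _ (fun t' => quadraticChar 𝓀[K] (IsLocalRing.residue 𝒪[K] ⟨-c, hcO⟩ * t') = 1) hA (fun κ hκ hpκ t ht h1 => by
        have h1' : quadraticChar 𝓀[K] (IsLocalRing.residue 𝒪[K] ⟨-c, hcO⟩ * IsLocalRing.residue 𝒪[K] t) = 1 := h1
        rw [hBpar κ hκ hpκ t ht, mul_zero, quadraticChar_zero] at h1'; exact zero_ne_one h1')]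
    have hcnt : 2 * ({c' | c' ∈ (latticeGraph σ ϖ ((StdForm.antidiagonal 3).over K)).neighborSet v ∧
          ∃ κ : unitaryGroupOfForm σ ((StdForm.antidiagonal 3).over K), κ ∈ unitaryInt σ ((StdForm.antidiagonal 3).over K) ∧
            c'.1 = mapGL (((u * κ : unitaryGroupOfForm σ ((StdForm.antidiagonal 3).over K)) : GL (Fin 3) K)) (latt (Matrix.diagonal ![(1 : K), 1, ϖ])) ∧
            ∃ t : 𝒪[K], (t : K) = (ϖ ^ d)⁻¹ * B₀ σ 3 (((κ : GL (Fin 3) K) : Matrix (Fin 3) (Fin 3) K) *ᵥ (Pi.single 0 1))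
          (((((u⁻¹ * γ * u : unitaryGroupOfForm σ ((StdForm.antidiagonal 3).over K)) : GL (Fin 3) K) : Matrix (Fin 3) (Fin 3) K) - 1) *ᵥ
            (((κ : GL (Fin 3) K) : Matrix (Fin 3) (Fin 3) K) *ᵥ (Pi.single 0 1))) ∧ quadraticChar 𝓀[K] (IsLocalRing.residue 𝒪[K] ⟨-c, hcO⟩ * IsLocalRing.residue 𝒪[K] t) = 1}).ncard = Nat.card 𝓀[K] - 1 := hcls1
    rw [Nat.choose_two_right, ← hcnt, Nat.mul_left_comm, Nat.mul_div_cancel_left _ Nat.two_pos]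
  · -- ### conjunct (iv): `#{(d−2)-grandchildren NOT of class c} = q · #{lines of class ≠ −c, non-null} = q · (q−1)∕2`
    have hA : ∀ (κ : unitaryGroupOfForm σ ((StdForm.antidiagonal 3).over K)) (hκ : κ ∈ unitaryInt σ ((StdForm.antidiagonal 3).over K)) (c' w : {M : Submodule 𝒪[K] (Fin 3 → K) // IsVertex σ ϖ ((StdForm.antidiagonal 3).over K) M}),
        c' = latticeGraphIso σ ϖ ((StdForm.antidiagonal 3).over K) (u * κ) N₁v → c' ≠ p → (latticeGraph σ ϖ ((StdForm.antidiagonal 3).over K)).Adj c' w → w ≠ v →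
        ∀ t : 𝒪[K], (t : K) = (ϖ ^ d)⁻¹ * B₀ σ 3 (((κ : GL (Fin 3) K) : Matrix (Fin 3) (Fin 3) K) *ᵥ (Pi.single 0 1))
          (((((u⁻¹ * γ * u : unitaryGroupOfForm σ ((StdForm.antidiagonal 3).over K)) : GL (Fin 3) K) : Matrix (Fin 3) (Fin 3) K) - 1) *ᵥ
            (((κ : GL (Fin 3) K) : Matrix (Fin 3) (Fin 3) K) *ᵥ (Pi.single 0 1))) → (quadraticChar 𝓀[K] (IsLocalRing.residue 𝒪[K] ⟨-c, hcO⟩ * IsLocalRing.residue 𝒪[K] t) = -1 ↔ ((w.1.map ((Matrix.toLin' (((γ : GL (Fin 3) K) : Matrix (Fin 3) (Fin 3) K) - 1)).restrictScalars 𝒪[K]) ≤ scaleLattice (ϖ ^ (d - 2)) w.1 ∧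
          ¬ w.1.map ((Matrix.toLin' (((γ : GL (Fin 3) K) : Matrix (Fin 3) (Fin 3) K) - 1)).restrictScalars 𝒪[K]) ≤ scaleLattice (ϖ ^ (d - 1)) w.1) ∧
        ¬ (∃ y ∈ w.1, ∃ a' : K, Valued.v a' = 1 ∧
            Valued.v ((ϖ ^ (d - 2))⁻¹ * pairing σ ((StdForm.antidiagonal 3).over K) y ((((γ : GL (Fin 3) K) : Matrix (Fin 3) (Fin 3) K) - 1) *ᵥ y) - c * a' ^ 2) < 1))) := by
      intro κ hκ c' w hcκ hcp hcw hwv t ht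
      obtain ⟨hne, hcls⟩ := hA23 κ hκ c' w hcκ hcp hcw hwv t ht
      constructor
      · intro h1
        have ht0 : IsLocalRing.residue 𝒪[K] t ≠ 0 := fun h0 => by
          rw [h0, mul_zero, quadraticChar_zero] at h1; exact absurd h1 (by decide)
        refine ⟨hne.1 ht0, fun hcl => ?_⟩
        have h1' := (hcls ht0).2 hcl
        rw [h1'] at h1; exact absurd h1 (by decide)
      · rintro ⟨hlab, hcl⟩
        have ht0 := hne.2 hlab
        have hne0 : IsLocalRing.residue 𝒪[K] ⟨-c, hcO⟩ * IsLocalRing.residue 𝒪[K] t ≠ 0 := mul_ne_zero hcres ht0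
        exact (quadraticChar_dichotomy hne0).resolve_left (fun h1 => hcl ((hcls ht0).1 h1))
    rw [ncard_fixedGrandchildren_sep_eq_mul_ncard_passingChildren hσ hvσ hσϖ hϖ hres h2 hT hvS hvr hfix hlev1 _ (by
      intro c' hvc hdc w w' hcw hdw hcw' hdw'
      obtain ⟨κ, hκ, hcκ⟩ := hframe c' hvc
      obtain ⟨t₀, ht₀, -, -, -⟩ := hdict κ hκ
      have hcp := hchild' c' hvc hdc
      have hwv : w ≠ v := by intro h; rw [h] at hdw; omega
      have hwv' : w' ≠ v := by intro h; rw [h] at hdw'; omega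
      rw [← hA κ hκ c' w hcκ hcp hcw hwv t₀ ht₀, ← hA κ hκ c' w' hcκ hcp hcw' hwv' t₀ ht₀]),
      hSet _ (fun t' => quadraticChar 𝓀[K] (IsLocalRing.residue 𝒪[K] ⟨-c, hcO⟩ * t') = -1) hA (fun κ hκ hpκ t ht h1 => by
        have h1' : quadraticChar 𝓀[K] (IsLocalRing.residue 𝒪[K] ⟨-c, hcO⟩ * IsLocalRing.residue 𝒪[K] t) = -1 := h1
        rw [hBpar κ hκ hpκ t ht, mul_zero, quadraticChar_zero] at h1'; exact absurd h1' (by decide))]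
    have hcnt : 2 * ({c' | c' ∈ (latticeGraph σ ϖ ((StdForm.antidiagonal 3).over K)).neighborSet v ∧
          ∃ κ : unitaryGroupOfForm σ ((StdForm.antidiagonal 3).over K), κ ∈ unitaryInt σ ((StdForm.antidiagonal 3).over K) ∧
            c'.1 = mapGL (((u * κ : unitaryGroupOfForm σ ((StdForm.antidiagonal 3).over K)) : GL (Fin 3) K)) (latt (Matrix.diagonal ![(1 : K), 1, ϖ])) ∧
            ∃ t : 𝒪[K], (t : K) = (ϖ ^ d)⁻¹ * B₀ σ 3 (((κ : GL (Fin 3) K) : Matrix (Fin 3) (Fin 3) K) *ᵥ (Pi.single 0 1))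
          (((((u⁻¹ * γ * u : unitaryGroupOfForm σ ((StdForm.antidiagonal 3).over K)) : GL (Fin 3) K) : Matrix (Fin 3) (Fin 3) K) - 1) *ᵥ
            (((κ : GL (Fin 3) K) : Matrix (Fin 3) (Fin 3) K) *ᵥ (Pi.single 0 1))) ∧ quadraticChar 𝓀[K] (IsLocalRing.residue 𝒪[K] ⟨-c, hcO⟩ * IsLocalRing.residue 𝒪[K] t) = -1}).ncard = Nat.card 𝓀[K] - 1 := hcls2
    rw [Nat.choose_two_right, ← hcnt, Nat.mul_left_comm, Nat.mul_div_cancel_left _ Nat.two_pos]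

end Literature.NumberTheory.Automorphic.UnitaryLatticeTree

end
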